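import Literature.NumberTheory.LFunctions.ConnesProlateGuessRate
import HarnessLib

/-!
# Connes' Fact 6.4 with the rate `O(λ⁻²)`

CCM25 (Connes–Consani–Moscovici, *Zeta zeros and prolate wave operators: semilocal adelic
operators*, 2025, proof of Lemma 7.3) and the Letter (Connes, *A letter on the Riemann
Hypothesis*, 2026, §6.4 Fact 6.4) state that for Connes' prolate combination
`h_λ = A(h_{4,λ} − ρ_λ h_{0,λ})` the completed Mellin transform `4M_λ(s)` converges to Riemann's
`ξ(½+s)`, with the printed rate `O(λ^{−1/2−Re s})` on closed substrips `|Re s| ≤ α₀ < ½`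
(`prolateGuess_rate`, file `ConnesProlateGuessRate.lean`).

This file proves the sharper rate `O(λ⁻²)`, uniform on closed substrips
(`prolateGuess_rate_sharp`).  In the decomposition
`4M_λ(s) − ξ(½+s) = 4ζ(s+½)(𝓜h_λ − 𝓜h)(s+½) − 4∫_0^{1/λ} 𝓔(h_λ)(u)u^{s−1}du`
(`four_mul_prolateGuessMellin_sub_riemannXi_of_even`) the first term is `O(λ⁻²)` by the `W^{1,1}`
rates of `ConnesProlateGuessRate.lean` (`prolateGuessH_rate`).  The printed rate comes from
bounding the boundary piece by the total variation, `(V_λ + M)λ^{−(½+Re s)}`.  Here instead we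
prove `|𝓔(h_λ)(u)| ≤ C√u/λ²` on `(0, 1/λ]` (`abs_connesE_prolateGuessH_le`), which makes the
boundary piece `O(λ⁻²)` as well.  Writing `𝓔(F)(u) = √u(∑_{n≥1} F(nu) − u⁻¹∫_0^∞ F)` as a sum
over cells `[(n−1)u, nu]`, each cell is compared with its integral: by a third-order
Euler–Maclaurin (Taylor) estimate on `[0, X]`, `X = λ^{1/5}`, where the telescoping first- and
second-order corrections are controlled by `F′(0) = 0` and by the smallness of `F, F′` at `X`
(Gaussian decay of `h_0, h_4` plus the `λ⁻²` sup-norm rate), and by a first-order estimate on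
`[X, λ]` fed with the `W^{1,1}` rate (`abs_connesE_le_of_cells`).  The third derivative of a
prolate function is computed from the prolate ODE (`IsProlateFunction.hasDerivAt_secondDeriv`)
and bounded on `[0, λ/2]` by `(1100 + 16μ)(1+x)³(|f| + |f′|)` (`abs_thirdDerivExpr_le`).

All inputs are theorems of the tree (the `λ⁻²` sup-norm rates `prolateSupNormRate_zero/_four`,
the eigenvalue localisation `IsProlateFunction.eigen_sub_le_of_zero/_four`, the `W^{1,1}` rates
`w11Rate_zero/_four`); nothing here uses RH, and no new axiom is introduced.  As a corollary the
named statement `prolateGuess_tendsto_riemannXi` (Fact 6.4 as printed) is re-derived in the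
closing `example` (it was first proved in `ConnesProlateGuessFact.lean`).
-/

noncomputable section

open Real MeasureTheory Set Filter Topology

namespace Literature.NumberTheory.LFunctions

/-! ### Polynomial × Gaussian: integrability and super-polynomial decay -/

/-- `p(x)·e^{−πx²}` is integrable on `ℝ` for every real polynomial `p`. [folklore] -/
theorem integrable_polynomial_mul_exp_neg_pi_sq (p : Polynomial ℝ) :
    Integrable fun x : ℝ ↦ p.eval x * Real.exp (-π * x ^ 2) := by
  induction p using Polynomial.induction_on' with
  | add p q hp hq =>
    refine (hp.add hq).congr (ae_of_all _ fun x ↦ ?_)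
    simp only [Pi.add_apply, Polynomial.eval_add, add_mul]
  | monomial n c =>
    refine ((integrable_pow_mul_exp_neg_pi_mul_sq n).const_mul c).congr (ae_of_all _ fun x ↦ ?_)
    simp only [Polynomial.eval_monomial]
    ring

/-- `p(x)·e^{−πx²}·x^a → 0` as `x → +∞`, for every real polynomial `p` and real `a`. [folklore] -/
theorem tendsto_polynomial_mul_exp_neg_pi_sq_mul_rpow (p : Polynomial ℝ) (a : ℝ) :
    Tendsto (fun x : ℝ ↦ p.eval x * Real.exp (-π * x ^ 2) * x ^ a) atTop (𝓝 0) := by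
  induction p using Polynomial.induction_on' with
  | add p q hp hq =>
    have h := hp.add hq
    rw [add_zero] at h
    refine h.congr' (Eventually.of_forall fun x ↦ ?_)
    simp only [Polynomial.eval_add]
    ring
  | monomial n c =>
    have hexp : Tendsto (fun x : ℝ ↦ Real.exp (-(1 / 2) * x)) atTop (𝓝 0) :=
      Real.tendsto_exp_comp_nhds_zero.mpr (tendsto_id.const_mul_atTop_of_neg (by norm_num))
    have h : Tendsto (fun x : ℝ ↦ x ^ ((n : ℝ) + a) * Real.exp (-π * x ^ 2)) atTop (𝓝 0) :=
      (rpow_mul_exp_neg_mul_sq_isLittleO_exp_neg Real.pi_pos _).trans_tendsto hexp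
    have h' := h.const_mul c
    rw [mul_zero] at h'
    refine h'.congr' ?_
    filter_upwards [eventually_gt_atTop (0 : ℝ)] with x hx
    simp only [Polynomial.eval_monomial]
    rw [Real.rpow_add hx, Real.rpow_natCast]
    ring

/-- Super-polynomial decay of a polynomial times the Gaussian: for `φ = p·e^{−πx²}` and `k : ℕ` there
is `X ≥ 1` with `|φ(x)|·x^k ≤ 1` for all `x ≥ X`. [folklore] -/
theorem exists_abs_mul_pow_le_one_of_polynomial_mul_exp {φ : ℝ → ℝ}
    (hφ : ∃ p : Polynomial ℝ, ∀ x, φ x = p.eval x * Real.exp (-π * x ^ 2)) (k : ℕ) :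
    ∃ X : ℝ, 1 ≤ X ∧ ∀ x : ℝ, X ≤ x → |φ x| * x ^ k ≤ 1 := by
  obtain ⟨p, hp⟩ := hφ
  have h := tendsto_polynomial_mul_exp_neg_pi_sq_mul_rpow p k
  have hev : ∀ᶠ x : ℝ in atTop, |φ x| * x ^ k ≤ 1 := by
    filter_upwards [h.eventually (gt_mem_nhds (show (0 : ℝ) < 1 by norm_num)),
      h.eventually (lt_mem_nhds (show (-1 : ℝ) < 0 by norm_num)), eventually_gt_atTop (0 : ℝ)]
      with x hx1 hx2 hx0
    rw [Real.rpow_natCast, ← hp x] at hx1 hx2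
    rw [← abs_of_pos (pow_pos hx0 k), ← abs_mul]
    exact abs_le.2 ⟨by linarith, by linarith⟩
  obtain ⟨X, hX⟩ := Filter.eventually_atTop.1 (hev.and (eventually_ge_atTop (1 : ℝ)))
  exact ⟨max X 1, le_max_right _ _, fun x hx ↦ (hX x ((le_max_left _ _).trans hx)).1⟩

/-- A polynomial multiple of `φ = p·e^{−πx²}` is integrable on `ℝ`. [folklore] -/
theorem integrable_polynomial_mul_of_polynomial_mul_exp {φ : ℝ → ℝ}
    (hφ : ∃ p : Polynomial ℝ, ∀ x, φ x = p.eval x * Real.exp (-π * x ^ 2)) (q : Polynomial ℝ) :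
    Integrable fun x : ℝ ↦ q.eval x * φ x := by
  obtain ⟨p, hp⟩ := hφ
  refine (integrable_polynomial_mul_exp_neg_pi_sq (q * p)).congr (ae_of_all _ fun x ↦ ?_)
  simp only [Polynomial.eval_mul, hp x]
  ring

/-- `h_0 = p·e^{−πx²}` with `p` a (constant) polynomial. [folklore] -/
theorem hermiteH0_eq_polynomial_mul_exp :
    ∃ p : Polynomial ℝ, ∀ x, hermiteH0 x = p.eval x * Real.exp (-π * x ^ 2) :=
  ⟨Polynomial.C ((2 : ℝ) ^ ((1 : ℝ) / 4)), fun x ↦ by simp [hermiteH0]⟩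

/-- `h_4 = p·e^{−πx²}` with `p` a polynomial. [folklore] -/
theorem hermiteH4_eq_polynomial_mul_exp :
    ∃ p : Polynomial ℝ, ∀ x, hermiteH4 x = p.eval x * Real.exp (-π * x ^ 2) := by
  refine ⟨Polynomial.C (16 * π ^ 2 / (16 * prolateGuessA)) * Polynomial.X ^ 4
      - Polynomial.C (24 * π / (16 * prolateGuessA)) * Polynomial.X ^ 2
      + Polynomial.C (3 / (16 * prolateGuessA)), fun x ↦ ?_⟩
  simp only [hermiteH4, Polynomial.eval_add, Polynomial.eval_sub, Polynomial.eval_mul,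
    Polynomial.eval_C, Polynomial.eval_pow, Polynomial.eval_X]
  ring

/-- `h_0′ = p·e^{−πx²}` with `p` a polynomial. [folklore] -/
theorem hermiteH0'_eq_polynomial_mul_exp :
    ∃ p : Polynomial ℝ, ∀ x, hermiteH0' x = p.eval x * Real.exp (-π * x ^ 2) := by
  refine ⟨Polynomial.C (-(2 * π * (2 : ℝ) ^ ((1 : ℝ) / 4))) * Polynomial.X, fun x ↦ ?_⟩
  simp only [hermiteH0', Polynomial.eval_mul, Polynomial.eval_C, Polynomial.eval_X]
  ring

/-- `h_4′ = p·e^{−πx²}` with `p` a polynomial. [folklore] -/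
theorem hermiteH4'_eq_polynomial_mul_exp :
    ∃ p : Polynomial ℝ, ∀ x, hermiteH4' x = p.eval x * Real.exp (-π * x ^ 2) := by
  refine ⟨Polynomial.C (-32 * π ^ 3 / (16 * prolateGuessA)) * Polynomial.X ^ 5
      + Polynomial.C (112 * π ^ 2 / (16 * prolateGuessA)) * Polynomial.X ^ 3
      - Polynomial.C (54 * π / (16 * prolateGuessA)) * Polynomial.X, fun x ↦ ?_⟩
  simp only [hermiteH4', Polynomial.eval_add, Polynomial.eval_sub, Polynomial.eval_mul,
    Polynomial.eval_C, Polynomial.eval_pow, Polynomial.eval_X]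
  ring

/-- `h(0) = 0` in the form `A·(h_4(0) − ρ·h_0(0)) = 0`. [folklore] -/
theorem prolateGuessA_mul_hermite_sub_zero :
    prolateGuessA * (hermiteH4 0 - hermiteRho * hermiteH0 0) = 0 := by
  rw [prolateGuessA_mul_hermite_sub]
  simp [connesHermiteH]

/-! ### Euler–Maclaurin cells -/

/-- First-order cell estimate: `|(b−a)·g(b) − ∫_a^b g| ≤ (b−a)·∫_a^b|g′|`. [folklore] -/
theorem abs_mul_sub_integral_le_of_hasDerivAt {g g₁ : ℝ → ℝ} {a b : ℝ} (hab : a ≤ b)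
    (hg : ∀ t ∈ Icc a b, HasDerivAt g (g₁ t) t) (hint : IntervalIntegrable g₁ volume a b) :
    |(b - a) * g b - ∫ t in a..b, g t| ≤ (b - a) * ∫ t in a..b, |g₁ t| := by
  have hcont : ContinuousOn g (Icc a b) := fun t ht ↦ (hg t ht).continuousAt.continuousWithinAt
  have hgi : IntervalIntegrable g volume a b := hcont.intervalIntegrable_of_Icc hab
  have h1 : (b - a) * g b - ∫ t in a..b, g t = ∫ t in a..b, (g b - g t) := by
    rw [intervalIntegral.integral_sub intervalIntegrable_const hgi, intervalIntegral.integral_const,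
      smul_eq_mul]
  rw [h1]
  have h2 : ∀ t ∈ uIoc a b, ‖g b - g t‖ ≤ ∫ x in a..b, |g₁ x| := by
    intro t ht
    rw [uIoc_of_le hab] at ht
    have hsub : ∀ x ∈ uIcc t b, HasDerivAt g (g₁ x) x := fun x hx ↦ by
      rw [uIcc_of_le ht.2] at hx
      exact hg x ⟨ht.1.le.trans hx.1, hx.2⟩
    have hint' : IntervalIntegrable g₁ volume t b :=
      hint.mono_set (by
        rw [uIcc_of_le hab, uIcc_of_le ht.2]
        exact Icc_subset_Icc ht.1.le le_rfl)
    rw [Real.norm_eq_abs, ← intervalIntegral.integral_eq_sub_of_hasDerivAt hsub hint']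
    calc |∫ x in t..b, g₁ x| ≤ ∫ x in t..b, |g₁ x| :=
          intervalIntegral.abs_integral_le_integral_abs ht.2
      _ ≤ ∫ x in a..b, |g₁ x| :=
          intervalIntegral.integral_mono_interval ht.1.le ht.2 le_rfl
            (Eventually.of_forall fun _ ↦ abs_nonneg _) hint.abs
  have h3 := intervalIntegral.norm_integral_le_of_norm_le_const h2
  rw [Real.norm_eq_abs, abs_of_nonneg (by linarith : 0 ≤ b - a)] at h3
  linarith [h3]

/-- Third-order Euler–Maclaurin cell estimate. With `u = b − a` and `g‴ = g₃`:
`|u·g(b) − ∫_a^b g − (u/2)(g(b) − g(a)) − (u²/12)(g′(b) − g′(a))| ≤ u³·∫_a^b|g‴|`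
(the cubic kernel `κ(t) = (t−a)²u/4 − (t−a)³/6 − u²(t−a)/12` vanishes at both ends and `|κ| ≤ u³`).
[folklore] -/
theorem abs_em3_cell_le {g g₁ g₂ g₃ : ℝ → ℝ} {a b : ℝ} (hab : a ≤ b)
    (hg : ∀ t ∈ Icc a b, HasDerivAt g (g₁ t) t) (hg₁ : ∀ t ∈ Icc a b, HasDerivAt g₁ (g₂ t) t)
    (hg₂ : ∀ t ∈ Icc a b, HasDerivAt g₂ (g₃ t) t) (hint : IntervalIntegrable g₃ volume a b) :
    |(b - a) * g b - (∫ t in a..b, g t)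
        - ((b - a) / 2 * (g b - g a) + (b - a) ^ 2 / 12 * (g₁ b - g₁ a))|
      ≤ (b - a) ^ 3 * ∫ t in a..b, |g₃ t| := by
  have hu0 : 0 ≤ b - a := by linarith
  -- the kernel `κ` and its derivatives `κ₁`, `κ₂` (and `κ₂′ = −1`)
  have dκ : ∀ t, HasDerivAt
      (fun t : ℝ ↦ (t - a) * (t - a) * ((b - a) / 4) - (t - a) * (t - a) * (t - a) / 6
        - (t - a) * ((b - a) ^ 2 / 12))
      ((t - a) * ((b - a) / 2) - (t - a) * (t - a) / 2 - (b - a) ^ 2 / 12) t := by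
    intro t
    have h1 : HasDerivAt (fun t : ℝ ↦ t - a) 1 t := (hasDerivAt_id t).sub_const a
    have h := (((h1.mul h1).mul_const ((b - a) / 4)).sub (((h1.mul h1).mul h1).div_const 6)).sub
      (h1.mul_const ((b - a) ^ 2 / 12))
    refine h.congr_deriv ?_
    try simp only [Pi.mul_apply]
    ring
  have dκ₁ : ∀ t, HasDerivAt
      (fun t : ℝ ↦ (t - a) * ((b - a) / 2) - (t - a) * (t - a) / 2 - (b - a) ^ 2 / 12)
      ((b - a) / 2 - (t - a)) t := by
    intro t
    have h1 : HasDerivAt (fun t : ℝ ↦ t - a) 1 t := (hasDerivAt_id t).sub_const a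
    have h := ((h1.mul_const ((b - a) / 2)).sub ((h1.mul h1).div_const 2)).sub_const
      ((b - a) ^ 2 / 12)
    refine h.congr_deriv ?_
    try simp only [Pi.mul_apply]
    ring
  have dκ₂ : ∀ t, HasDerivAt (fun t : ℝ ↦ (b - a) / 2 - (t - a)) (-1) t := by
    intro t
    have h1 : HasDerivAt (fun t : ℝ ↦ t - a) 1 t := (hasDerivAt_id t).sub_const a
    exact (h1.const_sub ((b - a) / 2)).congr_deriv (by ring)
  -- `Φ = κ g″ − κ₁ g′ + κ₂ g` has `Φ′ = κ g‴ − g`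
  have dΦ : ∀ t ∈ uIcc a b, HasDerivAt
      (fun t : ℝ ↦ ((t - a) * (t - a) * ((b - a) / 4) - (t - a) * (t - a) * (t - a) / 6
          - (t - a) * ((b - a) ^ 2 / 12)) * g₂ t
          - ((t - a) * ((b - a) / 2) - (t - a) * (t - a) / 2 - (b - a) ^ 2 / 12) * g₁ t
          + ((b - a) / 2 - (t - a)) * g t)
      (((t - a) * (t - a) * ((b - a) / 4) - (t - a) * (t - a) * (t - a) / 6
          - (t - a) * ((b - a) ^ 2 / 12)) * g₃ t - g t) t := by
    intro t ht
    rw [uIcc_of_le hab] at ht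
    have h := (((dκ t).mul (hg₂ t ht)).sub ((dκ₁ t).mul (hg₁ t ht))).add ((dκ₂ t).mul (hg t ht))
    refine h.congr_deriv ?_
    ring
  have hgc : ContinuousOn g (Icc a b) := fun t ht ↦ (hg t ht).continuousAt.continuousWithinAt
  have hgi : IntervalIntegrable g volume a b := hgc.intervalIntegrable_of_Icc hab
  have hκc : Continuous (fun t : ℝ ↦ (t - a) * (t - a) * ((b - a) / 4)
      - (t - a) * (t - a) * (t - a) / 6 - (t - a) * ((b - a) ^ 2 / 12)) := by fun_prop
  have hκg₃ : IntervalIntegrable (fun t : ℝ ↦ ((t - a) * (t - a) * ((b - a) / 4)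
      - (t - a) * (t - a) * (t - a) / 6 - (t - a) * ((b - a) ^ 2 / 12)) * g₃ t) volume a b :=
    hint.continuousOn_mul hκc.continuousOn
  have hFTC := intervalIntegral.integral_eq_sub_of_hasDerivAt dΦ (hκg₃.sub hgi)
  rw [intervalIntegral.integral_sub hκg₃ hgi] at hFTC
  -- evaluate the boundary terms: everything collapses
  have key : (b - a) * g b - (∫ t in a..b, g t)
        - ((b - a) / 2 * (g b - g a) + (b - a) ^ 2 / 12 * (g₁ b - g₁ a))
      = -∫ t in a..b, ((t - a) * (t - a) * ((b - a) / 4) - (t - a) * (t - a) * (t - a) / 6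
          - (t - a) * ((b - a) ^ 2 / 12)) * g₃ t := by
    linear_combination hFTC
  rw [key, abs_neg]
  -- `|∫ κ g‴| ≤ (b−a)³ ∫ |g‴|`
  have hκb : ∀ t ∈ Icc a b, |((t - a) * (t - a) * ((b - a) / 4) - (t - a) * (t - a) * (t - a) / 6
      - (t - a) * ((b - a) ^ 2 / 12))| ≤ (b - a) ^ 3 := by
    intro t ht
    have h0 : 0 ≤ t - a := by linarith [ht.1]
    have h1 : t - a ≤ b - a := by linarith [ht.2]
    have h2 : (t - a) * (t - a) ≤ (b - a) * (b - a) := mul_le_mul h1 h1 h0 hu0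
    have h3 : (t - a) * (t - a) * (t - a) ≤ (b - a) * (b - a) * (b - a) :=
      mul_le_mul h2 h1 h0 (mul_nonneg hu0 hu0)
    rw [abs_le]
    constructor
    · nlinarith [mul_nonneg h0 h0, mul_nonneg (mul_nonneg h0 h0) h0, mul_nonneg h0 hu0,
        mul_nonneg (mul_nonneg h0 h0) hu0, mul_nonneg h0 (mul_nonneg hu0 hu0),
        mul_nonneg (mul_nonneg hu0 hu0) hu0]
    · nlinarith [mul_nonneg h0 h0, mul_nonneg (mul_nonneg h0 h0) h0, mul_nonneg h0 hu0,
        mul_nonneg (mul_nonneg h0 h0) hu0, mul_nonneg h0 (mul_nonneg hu0 hu0),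
        mul_nonneg (mul_nonneg hu0 hu0) hu0]
  calc |∫ t in a..b, ((t - a) * (t - a) * ((b - a) / 4) - (t - a) * (t - a) * (t - a) / 6
          - (t - a) * ((b - a) ^ 2 / 12)) * g₃ t|
      ≤ ∫ t in a..b, |((t - a) * (t - a) * ((b - a) / 4) - (t - a) * (t - a) * (t - a) / 6
          - (t - a) * ((b - a) ^ 2 / 12)) * g₃ t| :=
        intervalIntegral.abs_integral_le_integral_abs hab
    _ ≤ ∫ t in a..b, (b - a) ^ 3 * |g₃ t| := by
        refine intervalIntegral.integral_mono_on hab hκg₃.abs (hint.abs.const_mul _) fun t ht ↦ ?_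
        rw [abs_mul]
        exact mul_le_mul_of_nonneg_right (hκb t ht) (abs_nonneg _)
    _ = (b - a) ^ 3 * ∫ t in a..b, |g₃ t| := intervalIntegral.integral_const_mul _ _

/-- Telescoping: if `|R k − (G(k+1) − G k)| ≤ ρ k` for `k < n` then
`|Σ_{k<n} R k − (G n − G 0)| ≤ Σ_{k<n} ρ k`. [folklore] -/
theorem abs_sum_sub_telescope_le {R G ρ : ℕ → ℝ} {n : ℕ}
    (h : ∀ k < n, |R k - (G (k + 1) - G k)| ≤ ρ k) :
    |∑ k ∈ Finset.range n, R k - (G n - G 0)| ≤ ∑ k ∈ Finset.range n, ρ k := by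
  rw [← Finset.sum_range_sub, ← Finset.sum_sub_distrib]
  exact (Finset.abs_sum_le_sum_abs _ _).trans
    (Finset.sum_le_sum fun k hk ↦ h k (Finset.mem_range.1 hk))

/-- For `F` vanishing on `(λ, ∞)`, `𝓔(F)(u) = √u·Σ_{n < ⌊λ/u⌋} F((n+1)u)` is a finite sum. [folklore] -/
theorem connesE_eq_sqrt_mul_sum {F : ℝ → ℝ} {lam u : ℝ} (hsupp : ∀ x, lam < x → F x = 0)
    (hu : 0 < u) :
    connesE F u = Real.sqrt u * ∑ n ∈ Finset.range ⌊lam / u⌋₊, F ((n + 1 : ℕ) * u) := by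
  unfold connesE
  congr 1
  refine tsum_eq_sum fun n hn ↦ hsupp _ ?_
  rw [Finset.mem_range, not_lt] at hn
  have h1 : lam / u < (n : ℝ) + 1 := by
    have := Nat.lt_floor_add_one (lam / u)
    have h2 : (⌊lam / u⌋₊ : ℝ) ≤ n := by exact_mod_cast hn
    linarith
  rw [div_lt_iff₀ hu] at h1
  push_cast
  linarith

/-! ### The cell-sum estimate for `𝓔(F)` on `(0, 1]` -/

set_option maxHeartbeats 1600000 in
/-- **Euler–Maclaurin estimate for `𝓔(F)(u)`, `0 < u ≤ 1`.**  Let `F` be continuous on `[0, λ]`,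
vanish on `(λ, ∞)`, have `∫_0^λ F = 0`, be differentiable on `[0, λ)` with `F′(0) = 0`, and three times
differentiable on `[0, X]` (`2 ≤ X ≤ λ − 1`).  Then, with `B₀ ≥ |F(0)|`, `B₁ ≥ sup_{[X/2, λ]}|F|`,
`B₂ ≥ sup_{[X/2, X]}|F′|`, `B₃ ≥ ∫_0^X|F‴|`, `B₄ ≥ ∫_{X/2}^λ|F′|`:
`|𝓔(F)(u)| ≤ √u·(B₀/2 + B₁/2 + u·B₂/12 + u²·B₃ + B₄ + 3B₁)`.
(Third-order Euler–Maclaurin on the cells inside `[0, X]`, first-order comparison on the cells in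
`[X, λ]`, and `∫_0^λ F = 0`.) [folklore] -/
theorem abs_connesE_le_of_cells {F F₁ F₂ F₃ : ℝ → ℝ} {lam X B₀ B₁ B₂ B₃ B₄ : ℝ}
    (hX : 2 ≤ X) (hXl : X + 1 ≤ lam)
    (hcont : ContinuousOn F (Icc 0 lam))
    (hF : ∀ t ∈ Ico 0 lam, HasDerivAt F (F₁ t) t)
    (hF₁ : ∀ t ∈ Icc 0 X, HasDerivAt F₁ (F₂ t) t)
    (hF₂ : ∀ t ∈ Icc 0 X, HasDerivAt F₂ (F₃ t) t)
    (hF₃i : IntervalIntegrable F₃ volume 0 X)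
    (hF₁i : IntervalIntegrable F₁ volume 0 lam)
    (hsupp : ∀ x, lam < x → F x = 0)
    (hint : ∫ t in (0 : ℝ)..lam, F t = 0)
    (hF10 : F₁ 0 = 0)
    (hB₀ : |F 0| ≤ B₀) (hB₁ : ∀ x ∈ Icc (X / 2) lam, |F x| ≤ B₁)
    (hB₂ : ∀ x ∈ Icc (X / 2) X, |F₁ x| ≤ B₂) (hB₃ : ∫ t in (0 : ℝ)..X, |F₃ t| ≤ B₃)
    (hB₄ : ∫ t in (X / 2)..lam, |F₁ t| ≤ B₄)
    {u : ℝ} (hu0 : 0 < u) (hu1 : u ≤ 1) :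
    |connesE F u| ≤ Real.sqrt u * (B₀ / 2 + B₁ / 2 + u * B₂ / 12 + u ^ 2 * B₃ + B₄ + 3 * B₁) := by
  have hlam0 : 0 < lam := by linarith
  have hXlam : X < lam := by linarith
  -- the integers `N = ⌊λ/u⌋ = M + 1`, `N₁ = ⌊X/u⌋`
  set N := ⌊lam / u⌋₊ with hNdef
  set N₁ := ⌊X / u⌋₊ with hN₁def
  have hNle : (N : ℝ) * u ≤ lam := by
    have h := Nat.floor_le (div_nonneg hlam0.le hu0.le : (0 : ℝ) ≤ lam / u)
    rw [le_div_iff₀ hu0] at h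
    exact h
  have hNgt : lam - u < N * u := by
    have h := Nat.lt_floor_add_one (lam / u)
    rw [div_lt_iff₀ hu0] at h
    have : ((⌊lam / u⌋₊ : ℝ) + 1) * u = N * u + u := by rw [hNdef]; ring
    linarith
  have hN₁le : (N₁ : ℝ) * u ≤ X := by
    have h := Nat.floor_le (div_nonneg (by linarith : (0 : ℝ) ≤ X) hu0.le)
    rw [le_div_iff₀ hu0] at h
    exact h
  have hN₁gt : X - u < N₁ * u := by
    have h := Nat.lt_floor_add_one (X / u)
    rw [div_lt_iff₀ hu0] at h
    have : ((⌊X / u⌋₊ : ℝ) + 1) * u = N₁ * u + u := by rw [hN₁def]; ring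
    linarith
  have hN1 : 1 ≤ N := by
    have h : (1 : ℝ) ≤ lam / u := by rw [le_div_iff₀ hu0]; linarith
    exact Nat.le_floor (by exact_mod_cast h)
  obtain ⟨M, hM⟩ : ∃ M : ℕ, N = M + 1 := ⟨N - 1, by omega⟩
  have hN₁M : N₁ ≤ M := by
    have h1 : (N₁ : ℝ) < N := by
      by_contra h
      rw [not_lt] at h
      have := mul_le_mul_of_nonneg_right h hu0.le
      linarith
    have h2 : N₁ < N := by exact_mod_cast h1
    omega
  have hMr : (M : ℝ) = N - 1 := by
    rw [hM]; push_cast; ring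
  have hMu : (M : ℝ) * u ≤ lam - u := by rw [hMr]; linarith
  have hMu' : lam - 2 * u < M * u := by rw [hMr]; nlinarith
  set x₁ : ℝ := (N₁ : ℝ) * u with hx₁def
  have hx₁X : x₁ ≤ X := hN₁le
  have hx₁l : X / 2 ≤ x₁ := by
    have : X - u < x₁ := hN₁gt
    linarith
  have hx₁0 : 0 ≤ x₁ := by linarith
  have hx₁M : x₁ ≤ M * u := by
    have : (N₁ : ℝ) ≤ M := by exact_mod_cast hN₁M
    exact mul_le_mul_of_nonneg_right this hu0.le
  -- cell endpoints
  set a : ℕ → ℝ := fun k ↦ (k : ℝ) * u with hadef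
  have ha_succ : ∀ k : ℕ, a (k + 1) = a k + u := by
    intro k; simp only [hadef]; push_cast; ring
  have ha_sub : ∀ k : ℕ, a (k + 1) - a k = u := by intro k; rw [ha_succ]; ring
  have ha_le : ∀ k : ℕ, a k ≤ a (k + 1) := by intro k; rw [ha_succ]; linarith
  have ha0 : a 0 = 0 := by simp [hadef]
  have ha_nonneg : ∀ k : ℕ, 0 ≤ a k := fun k ↦ by positivity
  have ha_mono : ∀ {j k : ℕ}, j ≤ k → a j ≤ a k := by
    intro j k hjk
    have : (j : ℝ) ≤ k := by exact_mod_cast hjk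
    exact mul_le_mul_of_nonneg_right this hu0.le
  have haM : a M ≤ lam - u := hMu
  have haN₁ : a N₁ = x₁ := rfl
  -- the finite sum
  rw [connesE_eq_sqrt_mul_sum hsupp hu0, ← hNdef]
  have hsum_split : ∑ n ∈ Finset.range N, F ((n + 1 : ℕ) * u)
      = ∑ k ∈ Finset.range M, F (a (k + 1)) + F (a (M + 1)) := by
    rw [hM, Finset.sum_range_succ]
  -- integrability of F on subintervals of [0, λ]
  have hFi : ∀ {c d : ℝ}, 0 ≤ c → c ≤ d → d ≤ lam → IntervalIntegrable F volume c d := by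
    intro c d hc hcd hd
    exact (hcont.mono (Icc_subset_Icc hc hd)).intervalIntegrable_of_Icc hcd
  -- the cell decomposition  u F(a(k+1)) = ∫_cell F + R k
  set T : ℕ → ℝ := fun k ↦ ∫ t in a k..a (k + 1), F t with hTdef
  set R : ℕ → ℝ := fun k ↦ u * F (a (k + 1)) - T k with hRdef
  have hcell : ∀ k, u * F (a (k + 1)) = T k + R k := by intro k; simp only [hRdef]; ring
  have hsumT : ∑ k ∈ Finset.range M, T k = ∫ t in (0 : ℝ)..a M, F t := by
    rw [← ha0]
    exact intervalIntegral.sum_integral_adjacent_intervals fun k hk ↦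
      hFi (ha_nonneg k) (ha_le k) (by
        have := ha_mono (Nat.succ_le_of_lt hk)
        linarith [haM])
  have hIM : ∫ t in (0 : ℝ)..a M, F t = -∫ t in a M..lam, F t := by
    have := intervalIntegral.integral_add_adjacent_intervals (hFi le_rfl (ha_nonneg M) (by linarith))
      (hFi (ha_nonneg M) (by linarith) le_rfl)
    rw [hint] at this
    linarith
  -- the tail integral and the last term
  have hX2lam : X / 2 ≤ lam - 2 := by linarith
  have htail : |∫ t in a M..lam, F t| ≤ 2 * u * B₁ := by
    have h := intervalIntegral.norm_integral_le_of_norm_le_const (a := a M) (b := lam) (C := B₁)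
      (f := F) (fun t ht ↦ by
        rw [uIoc_of_le (by linarith : a M ≤ lam)] at ht
        rw [Real.norm_eq_abs]
        exact hB₁ t ⟨by linarith [ht.1], ht.2⟩)
    rw [Real.norm_eq_abs, abs_of_nonneg (by linarith : 0 ≤ lam - a M)] at h
    have hB₁0 : 0 ≤ B₁ := (abs_nonneg _).trans (hB₁ lam ⟨by linarith, le_rfl⟩)
    calc |∫ t in a M..lam, F t| ≤ B₁ * (lam - a M) := h
      _ ≤ B₁ * (2 * u) := mul_le_mul_of_nonneg_left (by linarith) hB₁0
      _ = 2 * u * B₁ := by ring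
  have hlast : |F (a (M + 1))| ≤ B₁ := by
    refine hB₁ _ ⟨?_, ?_⟩
    · rw [ha_succ]; linarith
    · rw [ha_succ]
      have : a (M + 1) = N * u := by rw [hadef, hM]
      rw [← ha_succ, this]; exact hNle
  -- the EM3 cells k < N₁
  set G : ℕ → ℝ := fun k ↦ u / 2 * F (a k) + u ^ 2 / 12 * F₁ (a k) with hGdef
  have hEM3 : ∀ k < N₁, |R k - (G (k + 1) - G k)| ≤ u ^ 3 * ∫ t in a k..a (k + 1), |F₃ t| := by
    intro k hk
    have hk1 : a (k + 1) ≤ X := (ha_mono (Nat.succ_le_of_lt hk)).trans hx₁X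
    have hsubX : Icc (a k) (a (k + 1)) ⊆ Icc 0 X := Icc_subset_Icc (ha_nonneg k) hk1
    have h := abs_em3_cell_le (ha_le k)
      (fun t ht ↦ hF t ⟨(hsubX ht).1, lt_of_le_of_lt (hsubX ht).2 hXlam⟩)
      (fun t ht ↦ hF₁ t (hsubX ht)) (fun t ht ↦ hF₂ t (hsubX ht))
      (hF₃i.mono_set (by
        rw [uIcc_of_le (ha_le k), uIcc_of_le (by linarith : (0 : ℝ) ≤ X)]; exact hsubX))
    rw [ha_sub] at h
    have e : R k - (G (k + 1) - G k)
        = u * F (a (k + 1)) - (∫ t in a k..a (k + 1), F t)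
          - (u / 2 * (F (a (k + 1)) - F (a k)) + u ^ 2 / 12 * (F₁ (a (k + 1)) - F₁ (a k))) := by
      simp only [hRdef, hTdef, hGdef]; ring
    rw [e]; exact h
  have hsum3 : |∑ k ∈ Finset.range N₁, R k - (G N₁ - G 0)| ≤ u ^ 3 * B₃ := by
    refine (abs_sum_sub_telescope_le hEM3).trans ?_
    rw [← Finset.mul_sum]
    rw [intervalIntegral.sum_integral_adjacent_intervals fun k hk ↦
      (hF₃i.abs.mono_set (by
        rw [uIcc_of_le (ha_le k), uIcc_of_le (by linarith : (0 : ℝ) ≤ X)]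
        exact Icc_subset_Icc (ha_nonneg k) ((ha_mono (Nat.succ_le_of_lt hk)).trans hx₁X)))]
    refine mul_le_mul_of_nonneg_left ?_ (by positivity)
    rw [ha0, haN₁]
    calc ∫ t in (0 : ℝ)..x₁, |F₃ t| ≤ ∫ t in (0 : ℝ)..X, |F₃ t| :=
          intervalIntegral.integral_mono_interval le_rfl hx₁0 hx₁X
            (Eventually.of_forall fun _ ↦ abs_nonneg _) hF₃i.abs
      _ ≤ B₃ := hB₃
  have hG : G N₁ - G 0 = u / 2 * (F x₁ - F 0) + u ^ 2 / 12 * F₁ x₁ := by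
    simp only [hGdef, ha0, haN₁, hF10]; ring
  -- the first-order cells N₁ ≤ k < M
  have hEM1 : ∀ k ∈ Finset.Ico N₁ M, |R k| ≤ u * ∫ t in a k..a (k + 1), |F₁ t| := by
    intro k hk
    rw [Finset.mem_Ico] at hk
    have hk1 : a (k + 1) ≤ lam - u := (ha_mono (Nat.succ_le_of_lt hk.2)).trans haM
    have h := abs_mul_sub_integral_le_of_hasDerivAt (ha_le k)
      (fun t ht ↦ hF t ⟨(ha_nonneg k).trans ht.1, by linarith [ht.2]⟩)
      (hF₁i.mono_set (by
        rw [uIcc_of_le (ha_le k), uIcc_of_le hlam0.le]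
        exact Icc_subset_Icc (ha_nonneg k) (by linarith)))
    rw [ha_sub] at h
    exact h
  have hsum1 : |∑ k ∈ Finset.Ico N₁ M, R k| ≤ u * B₄ := by
    refine (Finset.abs_sum_le_sum_abs _ _).trans ((Finset.sum_le_sum hEM1).trans ?_)
    rw [← Finset.mul_sum]
    rw [intervalIntegral.sum_integral_adjacent_intervals_Ico hN₁M fun k hk ↦
      (hF₁i.abs.mono_set (by
        have hk2 : k < M := (Set.mem_Ico.mp hk).2
        rw [uIcc_of_le (ha_le k), uIcc_of_le hlam0.le]
        exact Icc_subset_Icc (ha_nonneg k)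
          (((ha_mono (Nat.succ_le_of_lt hk2)).trans haM).trans (by linarith))))]
    refine mul_le_mul_of_nonneg_left ?_ hu0.le
    rw [haN₁]
    calc ∫ t in x₁..a M, |F₁ t| ≤ ∫ t in (X / 2)..lam, |F₁ t| :=
          intervalIntegral.integral_mono_interval hx₁l hx₁M (by linarith)
            (Eventually.of_forall fun _ ↦ abs_nonneg _)
            (hF₁i.abs.mono_set (by
              rw [uIcc_of_le (by linarith : X / 2 ≤ lam), uIcc_of_le hlam0.le]
              exact Icc_subset_Icc (by linarith) le_rfl))
      _ ≤ B₄ := hB₄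
  -- assemble `u·Σ F((n+1)u)`
  have hB₁0 : 0 ≤ B₁ := (abs_nonneg _).trans (hB₁ lam ⟨by linarith, le_rfl⟩)
  have hident : u * ∑ n ∈ Finset.range N, F ((n + 1 : ℕ) * u)
      = -(∫ t in a M..lam, F t) + (∑ k ∈ Finset.range N₁, R k - (G N₁ - G 0))
        + (G N₁ - G 0) + ∑ k ∈ Finset.Ico N₁ M, R k + u * F (a (M + 1)) := by
    rw [hsum_split, mul_add, Finset.mul_sum, Finset.sum_congr rfl fun k _ ↦ hcell k,
      Finset.sum_add_distrib, hsumT, hIM, ← Finset.sum_range_add_sum_Ico _ hN₁M]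
    ring
  have hmain : |u * ∑ n ∈ Finset.range N, F ((n + 1 : ℕ) * u)|
      ≤ u * (B₀ / 2 + B₁ / 2 + u * B₂ / 12 + u ^ 2 * B₃ + B₄ + 3 * B₁) := by
    rw [hident]
    have hGb : |G N₁ - G 0| ≤ u / 2 * (B₁ + B₀) + u ^ 2 / 12 * B₂ := by
      rw [hG]
      have e1 : |F x₁| ≤ B₁ := hB₁ x₁ ⟨hx₁l, by linarith⟩
      have e2 : |F₁ x₁| ≤ B₂ := hB₂ x₁ ⟨hx₁l, hx₁X⟩
      calc |u / 2 * (F x₁ - F 0) + u ^ 2 / 12 * F₁ x₁|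
          ≤ |u / 2 * (F x₁ - F 0)| + |u ^ 2 / 12 * F₁ x₁| := abs_add_le _ _
        _ = u / 2 * |F x₁ - F 0| + u ^ 2 / 12 * |F₁ x₁| := by
            rw [abs_mul, abs_mul, abs_of_nonneg (by positivity : (0 : ℝ) ≤ u / 2),
              abs_of_nonneg (by positivity : (0 : ℝ) ≤ u ^ 2 / 12)]
        _ ≤ u / 2 * (|F x₁| + |F 0|) + u ^ 2 / 12 * |F₁ x₁| := by
            gcongr; exact abs_sub _ _
        _ ≤ u / 2 * (B₁ + B₀) + u ^ 2 / 12 * B₂ := by gcongr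
    have hl : |u * F (a (M + 1))| ≤ u * B₁ := by
      rw [abs_mul, abs_of_pos hu0]; exact mul_le_mul_of_nonneg_left hlast hu0.le
    calc |-(∫ t in a M..lam, F t) + (∑ k ∈ Finset.range N₁, R k - (G N₁ - G 0))
          + (G N₁ - G 0) + ∑ k ∈ Finset.Ico N₁ M, R k + u * F (a (M + 1))|
        ≤ |-(∫ t in a M..lam, F t)| + |∑ k ∈ Finset.range N₁, R k - (G N₁ - G 0)|
          + |G N₁ - G 0| + |∑ k ∈ Finset.Ico N₁ M, R k| + |u * F (a (M + 1))| := by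
          have t1 := abs_add_le (-(∫ t in a M..lam, F t) + (∑ k ∈ Finset.range N₁, R k - (G N₁ - G 0))
            + (G N₁ - G 0) + ∑ k ∈ Finset.Ico N₁ M, R k) (u * F (a (M + 1)))
          have t2 := abs_add_le (-(∫ t in a M..lam, F t) + (∑ k ∈ Finset.range N₁, R k - (G N₁ - G 0))
            + (G N₁ - G 0)) (∑ k ∈ Finset.Ico N₁ M, R k)
          have t3 := abs_add_le (-(∫ t in a M..lam, F t) + (∑ k ∈ Finset.range N₁, R k - (G N₁ - G 0)))
            (G N₁ - G 0)
          have t4 := abs_add_le (-(∫ t in a M..lam, F t)) (∑ k ∈ Finset.range N₁, R k - (G N₁ - G 0))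
          linarith
      _ ≤ 2 * u * B₁ + u ^ 3 * B₃ + (u / 2 * (B₁ + B₀) + u ^ 2 / 12 * B₂) + u * B₄ + u * B₁ := by
          rw [abs_neg]; gcongr
      _ = u * (B₀ / 2 + B₁ / 2 + u * B₂ / 12 + u ^ 2 * B₃ + B₄ + 3 * B₁) := by ring
  -- divide by `u` and multiply by `√u`
  have hsum_le : |∑ n ∈ Finset.range N, F ((n + 1 : ℕ) * u)|
      ≤ B₀ / 2 + B₁ / 2 + u * B₂ / 12 + u ^ 2 * B₃ + B₄ + 3 * B₁ := by
    rw [abs_mul, abs_of_pos hu0] at hmain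
    exact le_of_mul_le_mul_left hmain hu0
  rw [abs_mul, abs_of_nonneg (Real.sqrt_nonneg u)]
  exact mul_le_mul_of_nonneg_left hsum_le (Real.sqrt_nonneg u)

/-! ### The third derivative of a prolate function -/

/-- The second derivative `x ↦ (2x f′ + ((2πλx)² − χ) f)/(λ² − x²)` of a prolate function is
differentiable on `(−λ, λ)`, with derivative
`(2f′ + 4x·f″ + 8π²λ²x·f + ((2πλx)² − χ)·f′)/(λ² − x²)` (differentiate the prolate equation).
[folklore] -/
theorem IsProlateFunction.hasDerivAt_secondDeriv {lam : ℝ} {n : ℕ} {f : ℝ → ℝ}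
    (hf : IsProlateFunction lam n f) {χ : ℝ}
    (hχ : ∀ x ∈ Ioo (-lam) lam,
      -(deriv (fun y ↦ (lam ^ 2 - y ^ 2) * deriv f y) x) + (2 * π * lam * x) ^ 2 * f x = χ * f x)
    {x : ℝ} (hx : x ∈ Ioo (-lam) lam) :
    HasDerivAt (fun y ↦ (2 * y * deriv f y + ((2 * π * lam * y) ^ 2 - χ) * f y) / (lam ^ 2 - y ^ 2))
      ((2 * deriv f x
          + 4 * x * ((2 * x * deriv f x + ((2 * π * lam * x) ^ 2 - χ) * f x) / (lam ^ 2 - x ^ 2))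
          + 8 * π ^ 2 * lam ^ 2 * x * f x + ((2 * π * lam * x) ^ 2 - χ) * deriv f x)
        / (lam ^ 2 - x ^ 2)) x := by
  have hd1 : HasDerivAt f (deriv f x) x := (hf.differentiableAt hx).hasDerivAt
  have hd2 := hf.hasDerivAt_deriv hχ hx
  have hpos : 0 < lam ^ 2 - x ^ 2 := by nlinarith [hx.1, hx.2]
  have hV : HasDerivAt (fun y : ℝ ↦ (2 * π * lam * y) ^ 2 - χ) (8 * π ^ 2 * lam ^ 2 * x) x := by
    have e : (fun y : ℝ ↦ (2 * π * lam * y) ^ 2 - χ) = fun y ↦ 4 * π ^ 2 * lam ^ 2 * y ^ 2 - χ := by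
      funext y; ring
    rw [e]
    have h := ((hasDerivAt_pow 2 x).const_mul (4 * π ^ 2 * lam ^ 2)).sub_const χ
    simp only [Nat.cast_ofNat, Nat.add_one_sub_one, pow_one] at h
    exact h.congr_deriv (by ring)
  have hD : HasDerivAt (fun y : ℝ ↦ lam ^ 2 - y ^ 2) (-(2 * x)) x := by
    simpa using (hasDerivAt_pow 2 x).const_sub (lam ^ 2)
  have hN := (((hasDerivAt_id' x).const_mul 2).fun_mul hd2).fun_add (hV.fun_mul hd1)
  have h := hN.fun_div hD hpos.ne'
  refine h.congr_deriv ?_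
  field_simp
  ring

set_option maxHeartbeats 400000 in
/-- Size of the third derivative: for `λ ≥ 1`, `0 ≤ x ≤ λ/2`, `|χ − λ²μ| ≤ D ≤ λ²`, `μ ≥ 0`,
`|(2b + 4x·(2xb + ((2πλx)² − χ)a)/(λ² − x²) + 8π²λ²x·a + ((2πλx)² − χ)b)/(λ² − x²)|
≤ (1100 + 16μ)(1 + x)³(|a| + |b|)`. [folklore] -/
theorem abs_thirdDerivExpr_le {lam x χ μ D a b : ℝ} (hlam : 1 ≤ lam) (hx0 : 0 ≤ x)
    (hx : x ≤ lam / 2) (hμ : 0 ≤ μ) (hD : |χ - lam ^ 2 * μ| ≤ D) (hDl : D ≤ lam ^ 2) :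
    |(2 * b + 4 * x * ((2 * x * b + ((2 * π * lam * x) ^ 2 - χ) * a) / (lam ^ 2 - x ^ 2))
        + 8 * π ^ 2 * lam ^ 2 * x * a + ((2 * π * lam * x) ^ 2 - χ) * b) / (lam ^ 2 - x ^ 2)|
      ≤ (1100 + 16 * μ) * (1 + x) ^ 3 * (|a| + |b|) := by
  have hπ4 : π ≤ 4 := Real.pi_le_four
  have hπ0 : 0 < π := Real.pi_pos
  have hπ2 : π ^ 2 ≤ 16 := by nlinarith
  have hl2 : 1 ≤ lam ^ 2 := by nlinarith
  set d := lam ^ 2 - x ^ 2 with hd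
  have hdl : lam ^ 2 / 2 ≤ d := by rw [hd]; nlinarith
  have hdpos : 0 < d := by linarith
  set w := 64 * x ^ 2 + μ + 1 with hw
  have hw0 : 0 ≤ w := by rw [hw]; positivity
  have ha := abs_nonneg a
  have hb := abs_nonneg b
  -- `|V| ≤ λ² w`
  set V := (2 * π * lam * x) ^ 2 - χ with hVdef
  have hV : |V| ≤ lam ^ 2 * w := by
    have h1 : |V| ≤ (2 * π * lam * x) ^ 2 + lam ^ 2 * μ + D := by
      have : V = (2 * π * lam * x) ^ 2 - lam ^ 2 * μ - (χ - lam ^ 2 * μ) := by rw [hVdef]; ring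
      rw [this]
      have t := abs_sub ((2 * π * lam * x) ^ 2 - lam ^ 2 * μ) (χ - lam ^ 2 * μ)
      have t2 : |(2 * π * lam * x) ^ 2 - lam ^ 2 * μ| ≤ (2 * π * lam * x) ^ 2 + lam ^ 2 * μ := by
        have := abs_sub ((2 * π * lam * x) ^ 2) (lam ^ 2 * μ)
        rwa [abs_of_nonneg (by positivity : (0 : ℝ) ≤ (2 * π * lam * x) ^ 2),
          abs_of_nonneg (by positivity : (0 : ℝ) ≤ lam ^ 2 * μ)] at this
      linarith
    have h2 : (2 * π * lam * x) ^ 2 ≤ lam ^ 2 * (64 * x ^ 2) := by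
      have : (2 * π * lam * x) ^ 2 = 4 * π ^ 2 * (lam ^ 2 * x ^ 2) := by ring
      rw [this]; nlinarith [mul_nonneg (by positivity : (0 : ℝ) ≤ lam ^ 2) (sq_nonneg x)]
    rw [hw]; nlinarith
  -- `|Q| ≤ 4x|b| + 2w|a|`
  have hQ : |(2 * x * b + V * a) / d| ≤ 4 * x * |b| + 2 * w * |a| := by
    rw [abs_div, abs_of_pos hdpos, div_le_iff₀ hdpos]
    have hN : |2 * x * b + V * a| ≤ 2 * x * |b| + lam ^ 2 * w * |a| := by
      calc |2 * x * b + V * a| ≤ |2 * x * b| + |V * a| := abs_add_le _ _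
        _ = 2 * x * |b| + |V| * |a| := by
            rw [abs_mul (2 * x) b, abs_mul V a, abs_of_nonneg (by positivity : (0 : ℝ) ≤ 2 * x)]
        _ ≤ 2 * x * |b| + lam ^ 2 * w * |a| := by gcongr
    nlinarith [mul_nonneg (mul_nonneg (by norm_num : (0 : ℝ) ≤ 4) hx0) hb, mul_nonneg hw0 ha,
      mul_nonneg (mul_nonneg hx0 hb) (by linarith : (0 : ℝ) ≤ d - 1 / 2),
      mul_nonneg (mul_nonneg hw0 ha) (by linarith : (0 : ℝ) ≤ lam ^ 2 - 1)]
  -- the numerator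
  have hnum : |2 * b + 4 * x * ((2 * x * b + V * a) / d) + 8 * π ^ 2 * lam ^ 2 * x * a + V * b|
      ≤ 2 * |b| + 4 * x * (4 * x * |b| + 2 * w * |a|) + 128 * lam ^ 2 * x * |a| + lam ^ 2 * w * |b| := by
    have e1 : |2 * b| = 2 * |b| := by rw [abs_mul, abs_two]
    have e2 : |4 * x * ((2 * x * b + V * a) / d)| ≤ 4 * x * (4 * x * |b| + 2 * w * |a|) := by
      rw [abs_mul, abs_of_nonneg (by positivity : (0 : ℝ) ≤ 4 * x)]
      exact mul_le_mul_of_nonneg_left hQ (by positivity)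
    have e3 : |8 * π ^ 2 * lam ^ 2 * x * a| ≤ 128 * lam ^ 2 * x * |a| := by
      rw [abs_mul, abs_of_nonneg (by positivity : (0 : ℝ) ≤ 8 * π ^ 2 * lam ^ 2 * x)]
      have : 8 * π ^ 2 * lam ^ 2 * x ≤ 128 * lam ^ 2 * x := by
        nlinarith [mul_nonneg (by positivity : (0 : ℝ) ≤ lam ^ 2) hx0]
      exact mul_le_mul_of_nonneg_right this ha
    have e4 : |V * b| ≤ lam ^ 2 * w * |b| := by
      rw [abs_mul]; exact mul_le_mul_of_nonneg_right hV hb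
    have t1 := abs_add_le (2 * b + 4 * x * ((2 * x * b + V * a) / d) + 8 * π ^ 2 * lam ^ 2 * x * a) (V * b)
    have t2 := abs_add_le (2 * b + 4 * x * ((2 * x * b + V * a) / d)) (8 * π ^ 2 * lam ^ 2 * x * a)
    have t3 := abs_add_le (2 * b) (4 * x * ((2 * x * b + V * a) / d))
    linarith only [t1, t2, t3, e1, e2, e3, e4]
  rw [abs_div, abs_of_pos hdpos, div_le_iff₀ hdpos]
  refine hnum.trans ?_
  -- polynomial bookkeeping
  have hx1 : 0 ≤ 1 + x := by linarith
  have hc3 : (1 + x) ^ 3 = 1 + 3 * x + 3 * x ^ 2 + x ^ 3 := by ring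
  have hA : 4 * x * (2 * w) + 128 * x ≤ (550 + 8 * μ) * (1 + x) ^ 3 := by
    rw [hw, hc3]; nlinarith [pow_nonneg hx0 3, sq_nonneg x, mul_nonneg hμ hx0,
      mul_nonneg hμ (sq_nonneg x), mul_nonneg hμ (pow_nonneg hx0 3)]
  have hB : 2 + 16 * x ^ 2 + w ≤ (550 + 8 * μ) * (1 + x) ^ 3 := by
    rw [hw, hc3]; nlinarith [pow_nonneg hx0 3, sq_nonneg x, mul_nonneg hμ hx0,
      mul_nonneg hμ (sq_nonneg x), mul_nonneg hμ (pow_nonneg hx0 3)]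
  have hP : 0 ≤ (550 + 8 * μ) * (1 + x) ^ 3 := by positivity
  -- everything is ≤ λ² × (the λ-free coefficient)
  have s1 : 2 * |b| + 4 * x * (4 * x * |b| + 2 * w * |a|) + 128 * lam ^ 2 * x * |a| + lam ^ 2 * w * |b|
      ≤ lam ^ 2 * ((4 * x * (2 * w) + 128 * x) * |a| + (2 + 16 * x ^ 2 + w) * |b|) := by
    nlinarith [mul_nonneg hb (by linarith : (0 : ℝ) ≤ lam ^ 2 - 1),
      mul_nonneg (mul_nonneg (sq_nonneg x) hb) (by linarith : (0 : ℝ) ≤ lam ^ 2 - 1),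
      mul_nonneg (mul_nonneg (mul_nonneg hx0 hw0) ha) (by linarith : (0 : ℝ) ≤ lam ^ 2 - 1)]
  have s2 : (4 * x * (2 * w) + 128 * x) * |a| + (2 + 16 * x ^ 2 + w) * |b|
      ≤ (550 + 8 * μ) * (1 + x) ^ 3 * (|a| + |b|) := by
    nlinarith [mul_le_mul_of_nonneg_right hA ha, mul_le_mul_of_nonneg_right hB hb]
  have s3 : lam ^ 2 * ((550 + 8 * μ) * (1 + x) ^ 3 * (|a| + |b|))
      ≤ (1100 + 16 * μ) * (1 + x) ^ 3 * (|a| + |b|) * d := by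
    have : lam ^ 2 * ((550 + 8 * μ) * (1 + x) ^ 3 * (|a| + |b|))
        = (1100 + 16 * μ) * (1 + x) ^ 3 * (|a| + |b|) * (lam ^ 2 / 2) := by ring
    rw [this]
    exact mul_le_mul_of_nonneg_left hdl (by positivity)
  calc _ ≤ lam ^ 2 * ((4 * x * (2 * w) + 128 * x) * |a| + (2 + 16 * x ^ 2 + w) * |b|) := s1
    _ ≤ lam ^ 2 * ((550 + 8 * μ) * (1 + x) ^ 3 * (|a| + |b|)) :=
        mul_le_mul_of_nonneg_left s2 (by positivity)
    _ ≤ _ := s3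

/-! ### Closeness of the first derivatives on `[0, X]`, packaged -/

/-- From the sup-norm closeness `|f − g| ≤ C_S/λ²` and the eigenvalue window `|χ − λ²μ| ≤ D ≤ λ²`:
`|f′(x) − g′(x)| ≤ 2((4π² + μ + 1)(C_S + G) + D·G)·X⁵/λ²` for `x ∈ [0, X]`, `1 ≤ X`, `2X ≤ λ`.
[folklore] -/
theorem IsProlateFunction.abs_deriv_sub_le_pow_five {lam : ℝ} {n : ℕ} {f : ℝ → ℝ}
    (hf : IsProlateFunction lam n f) {χ : ℝ}
    (hχ : ∀ x ∈ Ioo (-lam) lam,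
      -(deriv (fun y ↦ (lam ^ 2 - y ^ 2) * deriv f y) x) + (2 * π * lam * x) ^ 2 * f x = χ * f x)
    {g g' : ℝ → ℝ} {μ : ℝ} (hg : ∀ x, HasDerivAt g (g' x) x)
    (hg' : ∀ x, HasDerivAt g' ((4 * π ^ 2 * x ^ 2 - μ) * g x) x) (hg'0 : g' 0 = 0)
    {G : ℝ} (hG : ∀ x, |g x| ≤ G) (hμ : 0 ≤ μ) {CS D : ℝ} (hCS : 0 ≤ CS)
    (hDχ : |χ - lam ^ 2 * μ| ≤ D) (hDl : D ≤ lam ^ 2)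
    (hδ : ∀ x ∈ Icc (-lam) lam, |f x - g x| ≤ CS / lam ^ 2)
    {X x : ℝ} (hX1 : 1 ≤ X) (hX : 2 * X ≤ lam) (hx : x ∈ Icc 0 X) :
    |deriv f x - g' x| ≤ 2 * ((4 * π ^ 2 + μ + 1) * (CS + G) + D * G) * X ^ 5 / lam ^ 2 := by
  have hlam := hf.lam_pos
  have hl2 : 0 < lam ^ 2 := by positivity
  have hG0 : 0 ≤ G := (abs_nonneg _).trans (hG 0)
  have hD0 : 0 ≤ D := (abs_nonneg _).trans hDχ
  have h := abs_deriv_sub_le_of_supNorm hf hχ hg hg' hg'0 hG hδ hX hx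
  have hχabs : |χ| ≤ lam ^ 2 * μ + lam ^ 2 := by
    have := abs_le.1 hDχ
    rw [abs_le]; constructor <;> nlinarith
  have hχ' : |lam ^ 2 * μ - χ| ≤ D := by rw [abs_sub_comm]; exact hDχ
  have hμabs : |μ| = μ := abs_of_nonneg hμ
  rw [hμabs] at h
  have hX0 : 0 ≤ X := by linarith
  have hX2 : X ^ 2 ≤ X ^ 5 := pow_le_pow_right₀ hX1 (by norm_num)
  have hX3 : X ^ 3 ≤ X ^ 5 := pow_le_pow_right₀ hX1 (by norm_num)
  have hX4 : X ^ 4 ≤ X ^ 5 := pow_le_pow_right₀ hX1 (by norm_num)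
  have hX5 : 1 ≤ X ^ 5 := one_le_pow₀ hX1
  -- bound the two products inside
  have p1 : ((2 * π * lam * X) ^ 2 + |χ|) * (CS / lam ^ 2) ≤ (4 * π ^ 2 + μ + 1) * CS * X ^ 2 := by
    have e : ((2 * π * lam * X) ^ 2 + |χ|) * (CS / lam ^ 2) = (4 * π ^ 2 * X ^ 2 + |χ| / lam ^ 2) * CS := by
      field_simp
      ring
    rw [e]
    have h1 : |χ| / lam ^ 2 ≤ μ + 1 := by
      rw [div_le_iff₀ hl2]; linarith
    have h2 : (4 * π ^ 2 * X ^ 2 + |χ| / lam ^ 2) * CS ≤ (4 * π ^ 2 * X ^ 2 + (μ + 1)) * CS := by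
      gcongr
    refine h2.trans ?_
    have hX12 : 1 ≤ X ^ 2 := one_le_pow₀ hX1
    nlinarith [mul_le_mul_of_nonneg_left hX12 (by positivity : (0 : ℝ) ≤ (μ + 1) * CS)]
  have p2 : (|lam ^ 2 * μ - χ| + X ^ 2 * (4 * π ^ 2 * X ^ 2 + μ)) * G
      ≤ (D + (4 * π ^ 2 + μ) * X ^ 4) * G := by
    refine mul_le_mul_of_nonneg_right ?_ hG0
    have : X ^ 2 * (4 * π ^ 2 * X ^ 2 + μ) = 4 * π ^ 2 * X ^ 4 + μ * X ^ 2 := by ring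
    rw [this]
    have hX24 : X ^ 2 ≤ X ^ 4 := pow_le_pow_right₀ hX1 (by norm_num)
    nlinarith [mul_le_mul_of_nonneg_left hX24 hμ]
  have hsum : X * (((2 * π * lam * X) ^ 2 + |χ|) * (CS / lam ^ 2)
      + (|lam ^ 2 * μ - χ| + X ^ 2 * (4 * π ^ 2 * X ^ 2 + μ)) * G)
      ≤ ((4 * π ^ 2 + μ + 1) * (CS + G) + D * G) * X ^ 5 := by
    have q0 := mul_le_mul_of_nonneg_left (add_le_add p1 p2) hX0
    have q1 : X * ((4 * π ^ 2 + μ + 1) * CS * X ^ 2) ≤ (4 * π ^ 2 + μ + 1) * CS * X ^ 5 := by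
      have : X * ((4 * π ^ 2 + μ + 1) * CS * X ^ 2) = (4 * π ^ 2 + μ + 1) * CS * X ^ 3 := by ring
      rw [this]; exact mul_le_mul_of_nonneg_left hX3 (by positivity)
    have q2 : X * ((D + (4 * π ^ 2 + μ) * X ^ 4) * G) ≤ D * G * X ^ 5 + (4 * π ^ 2 + μ) * G * X ^ 5 := by
      have e : X * ((D + (4 * π ^ 2 + μ) * X ^ 4) * G) = D * G * X + (4 * π ^ 2 + μ) * G * X ^ 5 := by
        ring
      rw [e]
      have hX15 : X ≤ X ^ 5 := by
        calc X = X ^ 1 := (pow_one X).symm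
          _ ≤ X ^ 5 := pow_le_pow_right₀ hX1 (by norm_num)
      nlinarith [mul_le_mul_of_nonneg_left hX15 (mul_nonneg hD0 hG0)]
    rw [mul_add] at q0
    nlinarith [q0, q1, q2, mul_nonneg hG0 (by positivity : (0 : ℝ) ≤ X ^ 5)]
  calc |deriv f x - g' x| ≤ _ := h
    _ ≤ 4 / (3 * lam ^ 2) * (((4 * π ^ 2 + μ + 1) * (CS + G) + D * G) * X ^ 5) :=
        mul_le_mul_of_nonneg_left hsum (by positivity)
    _ = (4 / 3) * ((((4 * π ^ 2 + μ + 1) * (CS + G) + D * G) * X ^ 5) / lam ^ 2) := by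
        field_simp
    _ ≤ 2 * ((((4 * π ^ 2 + μ + 1) * (CS + G) + D * G) * X ^ 5) / lam ^ 2) :=
        mul_le_mul_of_nonneg_right (by norm_num) (by positivity)
    _ = 2 * ((4 * π ^ 2 + μ + 1) * (CS + G) + D * G) * X ^ 5 / lam ^ 2 := by ring

/-! ### Per-`n` input package -/

/-- The inputs on `h_{n,λ}` used below, packaged with one constant `B`: sup-closeness `B/λ²`, the
eigenvalue, closeness of derivatives `B·X⁵/λ²` on windows `[0, X]` (`1 ≤ X ≤ λ/2`), and the size
`B(1+x)³(|f| + |f′|)` of the third derivative on `[0, λ/2]`. [folklore] -/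
theorem IsProlateFunction.inputs_of_rates {n : ℕ} {g g' : ℝ → ℝ} {μ : ℝ} (hμ : 0 < μ)
    (hg : ∀ x, HasDerivAt g (g' x) x) (hg' : ∀ x, HasDerivAt g' ((4 * π ^ 2 * x ^ 2 - μ) * g x) x)
    (hg'0 : g' 0 = 0) {G : ℝ} (hG : ∀ x, |g x| ≤ G) (hS : prolateSupNormRate n g)
    (hD : ∃ D Λ : ℝ, 0 ≤ D ∧ ∀ lam : ℝ, Λ ≤ lam → ∀ (f : ℝ → ℝ) (χ : ℝ),
      IsProlateFunction lam n f →
      (∀ x ∈ Ioo (-lam) lam, -(deriv (fun y ↦ (lam ^ 2 - y ^ 2) * deriv f y) x)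
        + (2 * π * lam * x) ^ 2 * f x = χ * f x) → |χ - lam ^ 2 * μ| ≤ D) :
    ∃ B Λ : ℝ, 0 ≤ B ∧ 1 ≤ Λ ∧ ∀ lam : ℝ, Λ ≤ lam → ∀ f : ℝ → ℝ, IsProlateFunction lam n f →
      (∀ x ∈ Icc (-lam) lam, |f x - g x| ≤ B / lam ^ 2) ∧
      ∃ χ : ℝ, (∀ x ∈ Ioo (-lam) lam, -(deriv (fun y ↦ (lam ^ 2 - y ^ 2) * deriv f y) x)
          + (2 * π * lam * x) ^ 2 * f x = χ * f x) ∧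
        (∀ X x : ℝ, 1 ≤ X → 2 * X ≤ lam → x ∈ Icc 0 X →
          |deriv f x - g' x| ≤ B * X ^ 5 / lam ^ 2) ∧
        (∀ x ∈ Icc 0 (lam / 2),
          |(2 * deriv f x + 4 * x * ((2 * x * deriv f x + ((2 * π * lam * x) ^ 2 - χ) * f x)
              / (lam ^ 2 - x ^ 2)) + 8 * π ^ 2 * lam ^ 2 * x * f x
              + ((2 * π * lam * x) ^ 2 - χ) * deriv f x) / (lam ^ 2 - x ^ 2)|
            ≤ B * (1 + x) ^ 3 * (|f x| + |deriv f x|)) := by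
  obtain ⟨CS, ΛS, hCS⟩ := hS
  obtain ⟨D, ΛD, hD0, hDb⟩ := hD
  have hG0 : 0 ≤ G := (abs_nonneg _).trans (hG 0)
  set CS' := max CS 0 with hCS'
  have hCS'0 : 0 ≤ CS' := le_max_right _ _
  set B := max (max CS' (2 * ((4 * π ^ 2 + μ + 1) * (CS' + G) + D * G))) (1100 + 16 * μ) with hB
  have hB1 : CS' ≤ B := (le_max_left _ _).trans (le_max_left _ _)
  have hB2 : 2 * ((4 * π ^ 2 + μ + 1) * (CS' + G) + D * G) ≤ B :=
    (le_max_right _ _).trans (le_max_left _ _)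
  have hB3 : 1100 + 16 * μ ≤ B := le_max_right _ _
  refine ⟨B, max (max ΛS ΛD) (max D 1), hCS'0.trans hB1, (le_max_right _ _).trans (le_max_right _ _),
    fun lam hlam f hf ↦ ?_⟩
  obtain ⟨h12, h34⟩ := max_le_iff.1 hlam
  obtain ⟨hlS, hlD⟩ := max_le_iff.1 h12
  obtain ⟨hlD', hl1⟩ := max_le_iff.1 h34
  have hl2 : 0 < lam ^ 2 := by positivity
  have hDl : D ≤ lam ^ 2 := hlD'.trans (by nlinarith)
  have hclose : ∀ x ∈ Icc (-lam) lam, |f x - g x| ≤ CS' / lam ^ 2 := fun x hx ↦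
    (hCS lam hlS f hf x hx).trans (div_le_div_of_nonneg_right (le_max_left _ _) hl2.le)
  obtain ⟨χ, hχ⟩ := hf.eigen
  have hDχ : |χ - lam ^ 2 * μ| ≤ D := hDb lam hlD f χ hf hχ
  refine ⟨fun x hx ↦ (hclose x hx).trans (div_le_div_of_nonneg_right hB1 hl2.le), χ, hχ,
    fun X x hX1 hX2 hx ↦ ?_, fun x hx ↦ ?_⟩
  · have h := hf.abs_deriv_sub_le_pow_five hχ hg hg' hg'0 hG hμ.le hCS'0 hDχ hDl hclose hX1 hX2 hx
    refine h.trans ?_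
    rw [mul_div_assoc, mul_div_assoc]
    exact mul_le_mul_of_nonneg_right hB2 (by positivity)
  · have h := abs_thirdDerivExpr_le (a := f x) (b := deriv f x) hl1 hx.1 hx.2 hμ.le hDχ hDl
    refine h.trans ?_
    have h13 : 0 ≤ (1 + x) ^ 3 := pow_nonneg (by linarith [hx.1]) 3
    exact mul_le_mul_of_nonneg_right (mul_le_mul_of_nonneg_right hB3 h13) (by positivity)

/-! ### The Euler–Maclaurin bound for `𝓔(h_λ)` on `(0, 1/λ]` -/

/-- `2^{1/4} ≤ 2`. [folklore] -/
theorem two_rpow_quarter_le_two : (2 : ℝ) ^ ((1 : ℝ) / 4) ≤ 2 := by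
  have h := Real.rpow_le_rpow_of_exponent_le (show (1 : ℝ) ≤ 2 by norm_num)
    (show (1 : ℝ) / 4 ≤ 1 by norm_num)
  rwa [Real.rpow_one] at h

/-- `0 < ρ = 3/(16·2^{1/4}·A)`. [folklore] -/
theorem hermiteRho_pos : 0 < hermiteRho := by
  unfold hermiteRho
  have := prolateGuessA_pos
  positivity

set_option maxHeartbeats 3200000 in
/-- **The λ⁻² bound for `𝓔(h_λ)` near `0`.**  There are `C, Λ` with
`|𝓔(h_λ)(u)| ≤ C·√u/λ²` for all `λ ≥ Λ`, all prolate `h_{0,λ}, h_{4,λ}` and all `0 < u ≤ 1/λ`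
(`h_λ = A(h_{4,λ} − ρ_λ h_{0,λ})` Connes' prolate combination).  Third-order Euler–Maclaurin on
`[0, λ^{1/5}]`, first-order comparison on `[λ^{1/5}, λ]`, fed with the `λ⁻²` sup-norm and
`W^{1,1}` rates of `h_{n,λ} → h_n` and the Gaussian decay of `h_0, h_4`. [folklore] -/
theorem abs_connesE_prolateGuessH_le :
    ∃ C Λ : ℝ, 0 ≤ C ∧ ∀ lam : ℝ, Λ ≤ lam → ∀ f0 f4 : ℝ → ℝ, IsProlateFunction lam 0 f0 →
      IsProlateFunction lam 4 f4 → ∀ u ∈ Ioc (0 : ℝ) (1 / lam),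
        |connesE (prolateGuessH lam f0 f4) u| ≤ Real.sqrt u * (C / lam ^ 2) := by
  have hπ := Real.pi_pos
  have hA := prolateGuessA_pos
  -- per-`n` inputs
  obtain ⟨B0, Λ0, hB00, hΛ0, hin0⟩ := IsProlateFunction.inputs_of_rates (n := 0) (μ := 2 * π)
    (by positivity) hasDerivAt_hermiteH0 hasDerivAt_hermiteH0' hermiteH0'_zero abs_hermiteH0_le
    prolateSupNormRate_zero IsProlateFunction.eigen_sub_le_of_zero
  obtain ⟨B4, Λ4, hB40, hΛ4, hin4⟩ := IsProlateFunction.inputs_of_rates (n := 4) (μ := 18 * π)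
    (by positivity) hasDerivAt_hermiteH4 hasDerivAt_hermiteH4' hermiteH4'_zero abs_hermiteH4_le
    prolateSupNormRate_four IsProlateFunction.eigen_sub_le_of_four
  set B := max B0 B4 with hBdef
  have hB0 : 0 ≤ B := hB00.trans (le_max_left _ _)
  -- `W^{1,1}` rates and the ratio rate
  obtain ⟨K0, ΛK0, hK0⟩ := w11Rate_zero
  obtain ⟨K4, ΛK4, hK4⟩ := w11Rate_four
  obtain ⟨KR, ΛR, hKR0, hKR⟩ := prolateGuessRatio_rate
    ⟨K0, ΛK0, fun lam hl f hf ↦ (hK0 lam hl f hf).2.1⟩ ⟨K4, ΛK4, fun lam hl f hf ↦ (hK4 lam hl f hf).2.1⟩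
  set KW := max (max K0 K4) 0 with hKWdef
  have hKW0 : 0 ≤ KW := le_max_right _ _
  set ρb := hermiteRho + KR with hρbdef
  have hρb0 : 0 ≤ ρb := by have := hermiteRho_pos; positivity
  -- Gaussian decay of the Hermite data
  obtain ⟨X₁, hX₁, hd0⟩ :=
    exists_abs_mul_pow_le_one_of_polynomial_mul_exp hermiteH0_eq_polynomial_mul_exp 10
  obtain ⟨X₂, hX₂, hd4⟩ :=
    exists_abs_mul_pow_le_one_of_polynomial_mul_exp hermiteH4_eq_polynomial_mul_exp 10
  obtain ⟨X₃, hX₃, hd0'⟩ :=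
    exists_abs_mul_pow_le_one_of_polynomial_mul_exp hermiteH0'_eq_polynomial_mul_exp 15
  obtain ⟨X₄, hX₄, hd4'⟩ :=
    exists_abs_mul_pow_le_one_of_polynomial_mul_exp hermiteH4'_eq_polynomial_mul_exp 15
  set Xd := max (max X₁ X₂) (max X₃ X₄) with hXddef
  have hXd1 : 1 ≤ Xd := hX₁.trans ((le_max_left _ _).trans (le_max_left _ _))
  -- the weighted Hermite integrals
  set q : Polynomial ℝ := (Polynomial.X + Polynomial.C 1) ^ 3 with hqdef
  have hqe : ∀ t : ℝ, q.eval t = (t + 1) ^ 3 := by intro t; simp [hqdef]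
  set H0 : ℝ → ℝ := fun t ↦ |q.eval t * hermiteH0 t| + |q.eval t * hermiteH0' t| with hH0def
  set H4 : ℝ → ℝ := fun t ↦ |q.eval t * hermiteH4 t| + |q.eval t * hermiteH4' t| with hH4def
  have iH0 : Integrable H0 :=
    (integrable_polynomial_mul_of_polynomial_mul_exp hermiteH0_eq_polynomial_mul_exp q).abs.add
      (integrable_polynomial_mul_of_polynomial_mul_exp hermiteH0'_eq_polynomial_mul_exp q).abs
  have iH4 : Integrable H4 :=
    (integrable_polynomial_mul_of_polynomial_mul_exp hermiteH4_eq_polynomial_mul_exp q).abs.add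
      (integrable_polynomial_mul_of_polynomial_mul_exp hermiteH4'_eq_polynomial_mul_exp q).abs
  have hH0nn : ∀ t, 0 ≤ H0 t := fun t ↦ by positivity
  have hH4nn : ∀ t, 0 ≤ H4 t := fun t ↦ by positivity
  set J0 := ∫ t, H0 t with hJ0def
  set J4 := ∫ t, H4 t with hJ4def
  have hJ0 : 0 ≤ J0 := integral_nonneg hH0nn
  have hJ4 : 0 ≤ J4 := integral_nonneg hH4nn
  have cH0 : Continuous H0 := by
    have hq := q.continuous
    exact ((hq.mul continuous_hermiteH0).abs).add ((hq.mul continuous_hermiteH0').abs)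
  have cH4 : Continuous H4 := by
    have hq := q.continuous
    exact ((hq.mul continuous_hermiteH4).abs).add ((hq.mul continuous_hermiteH4').abs)
  -- the constants
  set c0 : ℝ := prolateGuessA * ((1 + ρb) * B + 2 * KR) with hc0def
  set c1 : ℝ := prolateGuessA * (1 + ρb) * (B + 1024) with hc1def
  set c2 : ℝ := prolateGuessA * (1 + ρb) * (B + 2 ^ 15) with hc2def
  set c3 : ℝ := prolateGuessA * B * (J4 + ρb * J0 + (1 + ρb) * (16 * B)) with hc3def
  set c4 : ℝ := prolateGuessA * (1 + ρb) * (KW + 2 ^ 15) with hc4def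
  refine ⟨c0 / 2 + c1 / 2 + c2 / 12 + c3 + c4 + 3 * c1,
    max (max (max Λ0 Λ4) (max ΛK0 ΛK4)) (max (max ΛR 32) ((2 * Xd) ^ 5)),
    by positivity, fun lam hlam f0 f4 h0 h4 u hu ↦ ?_⟩
  -- unpack `λ ≥ Λ`
  obtain ⟨hA', hB'⟩ := max_le_iff.1 hlam
  obtain ⟨h04, hK04⟩ := max_le_iff.1 hA'
  obtain ⟨hl0, hl4⟩ := max_le_iff.1 h04
  obtain ⟨hlK0, hlK4⟩ := max_le_iff.1 hK04
  obtain ⟨hR32, hlXd⟩ := max_le_iff.1 hB'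
  obtain ⟨hlR, hl32⟩ := max_le_iff.1 hR32
  have hlam1 : 1 ≤ lam := by linarith
  have hlam0 : 0 < lam := by linarith
  have hl2 : 0 < lam ^ 2 := by positivity
  have hl21 : 1 ≤ lam ^ 2 := one_le_pow₀ hlam1
  obtain ⟨hu0, hul⟩ := hu
  have hu1 : u ≤ 1 := hul.trans (by rw [div_le_one hlam0]; exact hlam1)
  -- the split point `X = λ^{1/5}`
  set X : ℝ := lam ^ ((1 : ℝ) / 5) with hXdef
  have hX0 : 0 ≤ X := Real.rpow_nonneg hlam0.le _
  have hX5 : X ^ 5 = lam := by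
    rw [hXdef, ← Real.rpow_natCast, ← Real.rpow_mul hlam0.le]; norm_num
  have hX2 : 2 ≤ X := by
    have h : (2 : ℝ) ^ 5 ≤ X ^ 5 := by rw [hX5]; norm_num; linarith
    exact (pow_le_pow_iff_left₀ (by norm_num) hX0 (by norm_num)).1 h
  have hX1 : 1 ≤ X := by linarith
  have hXd : 2 * Xd ≤ X := by
    have h : (2 * Xd) ^ 5 ≤ X ^ 5 := by rw [hX5]; exact hlXd
    exact (pow_le_pow_iff_left₀ (by positivity) hX0 (by norm_num)).1 h
  have hX16 : 16 * X ≤ lam := by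
    have h4 : (16 : ℝ) ≤ X ^ 4 := by nlinarith [pow_le_pow_left₀ (by norm_num : (0:ℝ) ≤ 2) hX2 4]
    calc 16 * X ≤ X ^ 4 * X := by nlinarith
      _ = X ^ 5 := by ring
      _ = lam := hX5
  have hXl : X + 1 ≤ lam := by linarith
  have h2X : 2 * X ≤ lam := by linarith
  have hX4 : X ^ 4 ≤ lam := by
    calc X ^ 4 ≤ X ^ 5 := pow_le_pow_right₀ hX1 (by norm_num)
      _ = lam := hX5
  have hX9 : X ^ 9 ≤ lam ^ 2 := by
    calc X ^ 9 ≤ X ^ 10 := pow_le_pow_right₀ hX1 (by norm_num)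
      _ = (X ^ 5) ^ 2 := by ring
      _ = lam ^ 2 := by rw [hX5]
  have hX10 : (X / 2) ^ 10 = lam ^ 2 / 1024 := by
    have : (X / 2) ^ 10 = (X ^ 5) ^ 2 / 1024 := by ring
    rw [this, hX5]
  have hX15 : (X / 2) ^ 15 = lam ^ 3 / 2 ^ 15 := by
    have : (X / 2) ^ 15 = (X ^ 5) ^ 3 / 2 ^ 15 := by ring
    rw [this, hX5]
  -- decay consequences on `[X/2, ∞)`
  have hXd' : ∀ {x : ℝ}, X / 2 ≤ x → Xd ≤ x := fun hx ↦ by linarith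
  have dec10 : ∀ {φ : ℝ → ℝ} {Xk : ℝ}, Xk ≤ Xd → (∀ x, Xk ≤ x → |φ x| * x ^ 10 ≤ 1) →
      ∀ x, X / 2 ≤ x → |φ x| ≤ 1024 / lam ^ 2 := by
    intro φ Xk hXk hφ x hx
    have hxpos : 0 < x := by linarith
    have h1 := hφ x (hXk.trans (hXd' hx))
    have h2 : lam ^ 2 / 1024 ≤ x ^ 10 := by
      rw [← hX10]; exact pow_le_pow_left₀ (by linarith) hx 10
    have h3 : |φ x| * (lam ^ 2 / 1024) ≤ 1 :=
      (mul_le_mul_of_nonneg_left h2 (abs_nonneg _)).trans h1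
    rw [le_div_iff₀ hl2]; linarith
  have dec15 : ∀ {φ : ℝ → ℝ} {Xk : ℝ}, Xk ≤ Xd → (∀ x, Xk ≤ x → |φ x| * x ^ 15 ≤ 1) →
      ∀ x, X / 2 ≤ x → |φ x| ≤ 2 ^ 15 / lam ^ 3 := by
    intro φ Xk hXk hφ x hx
    have hxpos : 0 < x := by linarith
    have h1 := hφ x (hXk.trans (hXd' hx))
    have h2 : lam ^ 3 / 2 ^ 15 ≤ x ^ 15 := by
      rw [← hX15]; exact pow_le_pow_left₀ (by linarith) hx 15
    have h3 : |φ x| * (lam ^ 3 / 2 ^ 15) ≤ 1 :=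
      (mul_le_mul_of_nonneg_left h2 (abs_nonneg _)).trans h1
    have hl3 : 0 < lam ^ 3 := by positivity
    rw [le_div_iff₀ hl3]; linarith
  have hXd₁ : X₁ ≤ Xd := (le_max_left _ _).trans (le_max_left _ _)
  have hXd₂ : X₂ ≤ Xd := (le_max_right _ _).trans (le_max_left _ _)
  have hXd₃ : X₃ ≤ Xd := (le_max_left _ _).trans (le_max_right _ _)
  have hXd₄ : X₄ ≤ Xd := (le_max_right _ _).trans (le_max_right _ _)
  have e0 : ∀ x, X / 2 ≤ x → |hermiteH0 x| ≤ 1024 / lam ^ 2 := dec10 hXd₁ hd0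
  have e4 : ∀ x, X / 2 ≤ x → |hermiteH4 x| ≤ 1024 / lam ^ 2 := dec10 hXd₂ hd4
  have e0' : ∀ x, X / 2 ≤ x → |hermiteH0' x| ≤ 2 ^ 15 / lam ^ 3 := dec15 hXd₃ hd0'
  have e4' : ∀ x, X / 2 ≤ x → |hermiteH4' x| ≤ 2 ^ 15 / lam ^ 3 := dec15 hXd₄ hd4'
  have h15 : (2 : ℝ) ^ 15 / lam ^ 3 ≤ 2 ^ 15 / lam := by
    apply div_le_div_of_nonneg_left (by positivity) hlam0
    nlinarith
  -- unpack the inputs at this `λ`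
  obtain ⟨hS0, χ0, hχ0, hD0, hT0⟩ := hin0 lam hl0 f0 h0
  obtain ⟨hS4, χ4, hχ4, hD4, hT4⟩ := hin4 lam hl4 f4 h4
  have hBl0 : B0 ≤ B := le_max_left _ _
  have hBl4 : B4 ≤ B := le_max_right _ _
  obtain ⟨-, -, hW0⟩ := hK0 lam hlK0 f0 h0
  obtain ⟨-, -, hW4⟩ := hK4 lam hlK4 f4 h4
  have hKW0' : K0 ≤ KW := (le_max_left _ _).trans (le_max_left _ _)
  have hKW4' : K4 ≤ KW := (le_max_right _ _).trans (le_max_left _ _)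
  -- the ratio
  set ρl := prolateGuessRatio lam f0 f4 with hρldef
  have hρl : |ρl - hermiteRho| ≤ KR / lam ^ 2 := hKR lam hlR f0 f4 h0 h4
  have hKRl : KR / lam ^ 2 ≤ KR := div_le_self hKR0 hl21
  have hρlb : |ρl| ≤ ρb := by
    have h1 := abs_le.1 (hρl.trans hKRl)
    have hρ := hermiteRho_pos
    rw [hρbdef, abs_le]; constructor <;> linarith
  -- the functions
  set F := prolateGuessH lam f0 f4 with hFdef
  set F₁ : ℝ → ℝ := fun y ↦ prolateGuessA * (deriv f4 y - ρl * deriv f0 y) with hF₁def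
  set Q0 : ℝ → ℝ := fun y ↦
    (2 * y * deriv f0 y + ((2 * π * lam * y) ^ 2 - χ0) * f0 y) / (lam ^ 2 - y ^ 2) with hQ0def
  set Q4 : ℝ → ℝ := fun y ↦
    (2 * y * deriv f4 y + ((2 * π * lam * y) ^ 2 - χ4) * f4 y) / (lam ^ 2 - y ^ 2) with hQ4def
  set T0 : ℝ → ℝ := fun x ↦ (2 * deriv f0 x + 4 * x * ((2 * x * deriv f0 x
      + ((2 * π * lam * x) ^ 2 - χ0) * f0 x) / (lam ^ 2 - x ^ 2)) + 8 * π ^ 2 * lam ^ 2 * x * f0 x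
      + ((2 * π * lam * x) ^ 2 - χ0) * deriv f0 x) / (lam ^ 2 - x ^ 2) with hT0def
  set T4 : ℝ → ℝ := fun x ↦ (2 * deriv f4 x + 4 * x * ((2 * x * deriv f4 x
      + ((2 * π * lam * x) ^ 2 - χ4) * f4 x) / (lam ^ 2 - x ^ 2)) + 8 * π ^ 2 * lam ^ 2 * x * f4 x
      + ((2 * π * lam * x) ^ 2 - χ4) * deriv f4 x) / (lam ^ 2 - x ^ 2) with hT4def
  set F₂ : ℝ → ℝ := fun y ↦ prolateGuessA * (Q4 y - ρl * Q0 y) with hF₂def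
  set F₃ : ℝ → ℝ := fun y ↦ prolateGuessA * (T4 y - ρl * T0 y) with hF₃def
  -- structural hypotheses
  obtain ⟨⟨L, hL⟩, hsupp⟩ := prolateGuessH_lipschitz_support h0 h4
  have hcont : ContinuousOn F (Icc 0 lam) := hL.continuousOn
  have hint : ∫ t in (0 : ℝ)..lam, F t = 0 :=
    integral_zero_lam_prolateGuessH_eq_zero h0 h4 h0.even h4.even
      (integral_pos_of_isProlateFunction_zero h0).ne'
  have hIoo : ∀ {t : ℝ}, t ∈ Icc 0 X → t ∈ Ioo (-lam) lam := fun ht ↦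
    ⟨by linarith [ht.1], by linarith [ht.2]⟩
  have hF : ∀ t ∈ Ico 0 lam, HasDerivAt F (F₁ t) t := fun t ht ↦
    hasDerivAt_prolateGuessH h0 h4 ⟨by linarith [ht.1], ht.2⟩
  have hF₁ : ∀ t ∈ Icc 0 X, HasDerivAt F₁ (F₂ t) t := fun t ht ↦
    ((h4.hasDerivAt_deriv hχ4 (hIoo ht)).fun_sub
      ((h0.hasDerivAt_deriv hχ0 (hIoo ht)).const_mul ρl)).const_mul prolateGuessA
  have hF₂ : ∀ t ∈ Icc 0 X, HasDerivAt F₂ (F₃ t) t := fun t ht ↦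
    ((h4.hasDerivAt_secondDeriv hχ4 (hIoo ht)).fun_sub
      ((h0.hasDerivAt_secondDeriv hχ0 (hIoo ht)).const_mul ρl)).const_mul prolateGuessA
  have hF10 : F₁ 0 = 0 := by simp [hF₁def, h0.deriv_zero, h4.deriv_zero]
  have hF₁i : IntervalIntegrable F₁ volume 0 lam :=
    (h4.intervalIntegrable_deriv.sub (h0.intervalIntegrable_deriv.const_mul ρl)).const_mul _
  -- continuity of `F₃` on `[0, X]`
  have hne : ∀ x ∈ Icc 0 X, lam ^ 2 - x ^ 2 ≠ 0 := fun x hx ↦ by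
    have : x ^ 2 < lam ^ 2 := by nlinarith [hx.1, hx.2]
    linarith
  have hsubI : Icc 0 X ⊆ Ioo (-lam) lam := fun t ht ↦ hIoo ht
  have cT : ∀ {f : ℝ → ℝ} {m : ℕ} (hf : IsProlateFunction lam m f) (χ : ℝ),
      ContinuousOn (fun x ↦ (2 * deriv f x + 4 * x * ((2 * x * deriv f x
        + ((2 * π * lam * x) ^ 2 - χ) * f x) / (lam ^ 2 - x ^ 2)) + 8 * π ^ 2 * lam ^ 2 * x * f x
        + ((2 * π * lam * x) ^ 2 - χ) * deriv f x) / (lam ^ 2 - x ^ 2)) (Icc 0 X) := by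
    intro f m hf χ
    have hfc : ContinuousOn f (Icc 0 X) :=
      hf.contDiffOn.continuousOn.mono (fun t ht ↦ ⟨by linarith [ht.1], by linarith [ht.2]⟩)
    have hdc : ContinuousOn (fun x ↦ deriv f x) (Icc 0 X) := hf.continuousOn_deriv.mono hsubI
    have hVc : ContinuousOn (fun x : ℝ ↦ (2 * π * lam * x) ^ 2 - χ) (Icc 0 X) := by fun_prop
    have hDc : ContinuousOn (fun x : ℝ ↦ lam ^ 2 - x ^ 2) (Icc 0 X) := by fun_prop
    have hQc : ContinuousOn (fun x ↦ (2 * x * deriv f x + ((2 * π * lam * x) ^ 2 - χ) * f x)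
        / (lam ^ 2 - x ^ 2)) (Icc 0 X) :=
      ((((by fun_prop : ContinuousOn (fun x : ℝ ↦ 2 * x) (Icc 0 X)).mul hdc).add
        (hVc.mul hfc)).div hDc hne)
    exact (((((continuousOn_const.mul hdc).add
      ((by fun_prop : ContinuousOn (fun x : ℝ ↦ 4 * x) (Icc 0 X)).mul hQc)).add
      ((by fun_prop : ContinuousOn (fun x : ℝ ↦ 8 * π ^ 2 * lam ^ 2 * x) (Icc 0 X)).mul hfc)).add
      (hVc.mul hdc)).div hDc hne)
  have cF₃ : ContinuousOn F₃ (Icc 0 X) :=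
    continuousOn_const.mul ((cT h4 χ4).sub (continuousOn_const.mul (cT h0 χ0)))
  have hF₃i : IntervalIntegrable F₃ volume 0 X := cF₃.intervalIntegrable_of_Icc hX0
  -- (b0) the value at 0
  have hB₀ : |F 0| ≤ c0 / lam ^ 2 := by
    have e : F 0 = prolateGuessA * ((f4 0 - hermiteH4 0) - ρl * (f0 0 - hermiteH0 0))
        - prolateGuessA * (ρl - hermiteRho) * hermiteH0 0 := by
      have h00 := prolateGuessA_mul_hermite_sub_zero
      rw [hFdef, prolateGuessH_eq]
      linear_combination h00
    rw [e]
    have t1 : |f4 0 - hermiteH4 0| ≤ B / lam ^ 2 :=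
      (hS4 0 ⟨by linarith, by linarith⟩).trans (div_le_div_of_nonneg_right hBl4 hl2.le)
    have t0 : |f0 0 - hermiteH0 0| ≤ B / lam ^ 2 :=
      (hS0 0 ⟨by linarith, by linarith⟩).trans (div_le_div_of_nonneg_right hBl0 hl2.le)
    have th : |hermiteH0 0| ≤ 2 := (abs_hermiteH0_le 0).trans two_rpow_quarter_le_two
    calc |prolateGuessA * ((f4 0 - hermiteH4 0) - ρl * (f0 0 - hermiteH0 0))
          - prolateGuessA * (ρl - hermiteRho) * hermiteH0 0|
        ≤ |prolateGuessA * ((f4 0 - hermiteH4 0) - ρl * (f0 0 - hermiteH0 0))|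
          + |prolateGuessA * (ρl - hermiteRho) * hermiteH0 0| := abs_sub _ _
      _ ≤ prolateGuessA * (B / lam ^ 2 + ρb * (B / lam ^ 2))
          + prolateGuessA * (KR / lam ^ 2) * 2 := by
          gcongr
          · rw [abs_mul, abs_of_pos hA]
            refine mul_le_mul_of_nonneg_left ?_ hA.le
            calc |(f4 0 - hermiteH4 0) - ρl * (f0 0 - hermiteH0 0)|
                ≤ |f4 0 - hermiteH4 0| + |ρl * (f0 0 - hermiteH0 0)| := abs_sub _ _
              _ = |f4 0 - hermiteH4 0| + |ρl| * |f0 0 - hermiteH0 0| := by rw [abs_mul]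
              _ ≤ B / lam ^ 2 + ρb * (B / lam ^ 2) := by gcongr
          · rw [abs_mul, abs_mul, abs_of_pos hA]
            gcongr
      _ = c0 / lam ^ 2 := by rw [hc0def]; ring
  -- (b1) the size of `F` on `[X/2, λ]`
  have hB₁ : ∀ x ∈ Icc (X / 2) lam, |F x| ≤ c1 / lam ^ 2 := by
    intro x hx
    have hxI : x ∈ Icc (-lam) lam := ⟨by linarith [hx.1], hx.2⟩
    have e : F x = prolateGuessA * ((f4 x - hermiteH4 x) + hermiteH4 x
        - ρl * ((f0 x - hermiteH0 x) + hermiteH0 x)) := by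
      rw [hFdef, prolateGuessH_eq]; ring
    rw [e, abs_mul, abs_of_pos hA, hc1def]
    have t4 : |f4 x - hermiteH4 x| ≤ B / lam ^ 2 :=
      (hS4 x hxI).trans (div_le_div_of_nonneg_right hBl4 hl2.le)
    have t0 : |f0 x - hermiteH0 x| ≤ B / lam ^ 2 :=
      (hS0 x hxI).trans (div_le_div_of_nonneg_right hBl0 hl2.le)
    have s4 := e4 x hx.1
    have s0 := e0 x hx.1
    have : |(f4 x - hermiteH4 x) + hermiteH4 x - ρl * ((f0 x - hermiteH0 x) + hermiteH0 x)|
        ≤ (B / lam ^ 2 + 1024 / lam ^ 2) + ρb * (B / lam ^ 2 + 1024 / lam ^ 2) := by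
      calc _ ≤ |(f4 x - hermiteH4 x) + hermiteH4 x| + |ρl * ((f0 x - hermiteH0 x) + hermiteH0 x)| :=
            abs_sub _ _
        _ ≤ (|f4 x - hermiteH4 x| + |hermiteH4 x|) + |ρl| * (|f0 x - hermiteH0 x| + |hermiteH0 x|) := by
            rw [abs_mul]
            gcongr
            · exact abs_add_le _ _
            · exact abs_add_le _ _
        _ ≤ _ := by gcongr
    calc prolateGuessA * |(f4 x - hermiteH4 x) + hermiteH4 x - ρl * ((f0 x - hermiteH0 x) + hermiteH0 x)|
        ≤ prolateGuessA * ((B / lam ^ 2 + 1024 / lam ^ 2) + ρb * (B / lam ^ 2 + 1024 / lam ^ 2)) :=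
          mul_le_mul_of_nonneg_left this hA.le
      _ = prolateGuessA * (1 + ρb) * (B + 1024) / lam ^ 2 := by ring
  -- (b2) the size of `F₁` on `[X/2, X]`
  have hder0 : ∀ x ∈ Icc 0 X, |deriv f0 x - hermiteH0' x| ≤ B / lam := by
    intro x hx
    have h := hD0 X x hX1 h2X hx
    rw [hX5] at h
    calc |deriv f0 x - hermiteH0' x| ≤ B0 * lam / lam ^ 2 := h
      _ = B0 / lam := by field_simp
      _ ≤ B / lam := div_le_div_of_nonneg_right hBl0 hlam0.le
  have hder4 : ∀ x ∈ Icc 0 X, |deriv f4 x - hermiteH4' x| ≤ B / lam := by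
    intro x hx
    have h := hD4 X x hX1 h2X hx
    rw [hX5] at h
    calc |deriv f4 x - hermiteH4' x| ≤ B4 * lam / lam ^ 2 := h
      _ = B4 / lam := by field_simp
      _ ≤ B / lam := div_le_div_of_nonneg_right hBl4 hlam0.le
  have hB₂ : ∀ x ∈ Icc (X / 2) X, |F₁ x| ≤ c2 / lam := by
    intro x hx
    have hx0 : x ∈ Icc 0 X := ⟨by linarith [hx.1], hx.2⟩
    have t4 := hder4 x hx0
    have t0 := hder0 x hx0
    have s4 := (e4' x hx.1).trans h15
    have s0 := (e0' x hx.1).trans h15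
    have e : F₁ x = prolateGuessA * ((deriv f4 x - hermiteH4' x) + hermiteH4' x
        - ρl * ((deriv f0 x - hermiteH0' x) + hermiteH0' x)) := by
      simp only [hF₁def]; ring
    rw [e, abs_mul, abs_of_pos hA, hc2def]
    have : |(deriv f4 x - hermiteH4' x) + hermiteH4' x
        - ρl * ((deriv f0 x - hermiteH0' x) + hermiteH0' x)|
        ≤ (B / lam + 2 ^ 15 / lam) + ρb * (B / lam + 2 ^ 15 / lam) := by
      calc _ ≤ |(deriv f4 x - hermiteH4' x) + hermiteH4' x|
            + |ρl * ((deriv f0 x - hermiteH0' x) + hermiteH0' x)| := abs_sub _ _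
        _ ≤ (|deriv f4 x - hermiteH4' x| + |hermiteH4' x|)
            + |ρl| * (|deriv f0 x - hermiteH0' x| + |hermiteH0' x|) := by
            rw [abs_mul]
            gcongr
            · exact abs_add_le _ _
            · exact abs_add_le _ _
        _ ≤ _ := by gcongr
    calc prolateGuessA * |(deriv f4 x - hermiteH4' x) + hermiteH4' x
          - ρl * ((deriv f0 x - hermiteH0' x) + hermiteH0' x)|
        ≤ prolateGuessA * ((B / lam + 2 ^ 15 / lam) + ρb * (B / lam + 2 ^ 15 / lam)) :=
          mul_le_mul_of_nonneg_left this hA.le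
      _ = prolateGuessA * (1 + ρb) * (B + 2 ^ 15) / lam := by ring
  -- (b3) `∫_0^X |F₃|`
  set E : ℝ := (1 + X) ^ 3 * (2 * B * X ^ 5 / lam ^ 2) with hEdef
  have hE0 : 0 ≤ E := by positivity
  have hEX : E * X ≤ 16 * B := by
    have h1 : (1 + X) ^ 3 ≤ 8 * X ^ 3 :=
      (pow_le_pow_left₀ (by linarith only [hX0]) (by linarith only [hX1] : 1 + X ≤ 2 * X) 3).trans_eq
        (by ring)
    have h2 : E * X = (1 + X) ^ 3 * X ^ 6 * (2 * B) / lam ^ 2 := by rw [hEdef]; ring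
    rw [h2, div_le_iff₀ hl2]
    have h3 : (1 + X) ^ 3 * X ^ 6 ≤ 8 * X ^ 9 :=
      (mul_le_mul_of_nonneg_right h1 (pow_nonneg hX0 6)).trans_eq (by ring)
    calc (1 + X) ^ 3 * X ^ 6 * (2 * B) ≤ 8 * X ^ 9 * (2 * B) :=
          mul_le_mul_of_nonneg_right h3 (by positivity)
      _ = 16 * B * X ^ 9 := by ring
      _ ≤ 16 * B * lam ^ 2 := mul_le_mul_of_nonneg_left hX9 (by positivity)
  have hTb : ∀ {f : ℝ → ℝ} {m : ℕ} {h h' : ℝ → ℝ} {χ Bm : ℝ} (hf : IsProlateFunction lam m f),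
      Bm ≤ B →
      (∀ x ∈ Icc (-lam) lam, |f x - h x| ≤ Bm / lam ^ 2) →
      (∀ x ∈ Icc 0 X, |deriv f x - h' x| ≤ B / lam) →
      (∀ x ∈ Icc 0 (lam / 2), |(2 * deriv f x + 4 * x * ((2 * x * deriv f x
        + ((2 * π * lam * x) ^ 2 - χ) * f x) / (lam ^ 2 - x ^ 2)) + 8 * π ^ 2 * lam ^ 2 * x * f x
        + ((2 * π * lam * x) ^ 2 - χ) * deriv f x) / (lam ^ 2 - x ^ 2)|
          ≤ Bm * (1 + x) ^ 3 * (|f x| + |deriv f x|)) →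
      ∀ t ∈ Icc 0 X, |(2 * deriv f t + 4 * t * ((2 * t * deriv f t
        + ((2 * π * lam * t) ^ 2 - χ) * f t) / (lam ^ 2 - t ^ 2)) + 8 * π ^ 2 * lam ^ 2 * t * f t
        + ((2 * π * lam * t) ^ 2 - χ) * deriv f t) / (lam ^ 2 - t ^ 2)|
        ≤ B * ((|q.eval t * h t| + |q.eval t * h' t|) + E) := by
    intro f m h h' χ Bm hf hBm hS hd hT t ht
    have ht2 : t ∈ Icc 0 (lam / 2) := ⟨ht.1, by linarith [ht.2]⟩
    have hBm0 : 0 ≤ Bm := by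
      have := (abs_nonneg _).trans (hS 0 ⟨by linarith, by linarith⟩)
      rw [le_div_iff₀ hl2] at this; linarith
    refine (hT t ht2).trans ?_
    have hq3 : q.eval t = (1 + t) ^ 3 := by rw [hqe]; ring
    have hq0 : 0 ≤ (1 + t) ^ 3 := pow_nonneg (by linarith [ht.1]) 3
    have a1 : |f t| ≤ |h t| + B / lam ^ 2 := by
      have := hS t ⟨by linarith [ht.1], by linarith [ht.2]⟩
      have h2 : Bm / lam ^ 2 ≤ B / lam ^ 2 := div_le_div_of_nonneg_right hBm hl2.le
      have h3 := abs_sub_abs_le_abs_sub (f t) (h t)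
      linarith
    have a2 : |deriv f t| ≤ |h' t| + B / lam := by
      have := hd t ht
      have h3 := abs_sub_abs_le_abs_sub (deriv f t) (h' t)
      linarith
    have a3 : B / lam ^ 2 + B / lam ≤ 2 * B * X ^ 5 / lam ^ 2 := by
      rw [hX5]
      have e1 : B / lam ≤ B * lam / lam ^ 2 := by
        rw [div_le_div_iff₀ hlam0 hl2]
        exact le_of_eq (by ring)
      have e2 : B / lam ^ 2 ≤ B * lam / lam ^ 2 :=
        div_le_div_of_nonneg_right (by nlinarith) hl2.le
      have e3 : B * lam / lam ^ 2 + B * lam / lam ^ 2 = 2 * B * lam / lam ^ 2 := by ring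
      linarith
    have hqabs : |q.eval t * h t| + |q.eval t * h' t| = (1 + t) ^ 3 * (|h t| + |h' t|) := by
      rw [abs_mul, abs_mul, hq3, abs_of_nonneg hq0]; ring
    rw [hqabs]
    have hE' : (1 + t) ^ 3 * (B / lam ^ 2 + B / lam) ≤ E := by
      rw [hEdef]
      exact mul_le_mul (pow_le_pow_left₀ (by linarith [ht.1]) (by linarith [ht.2]) 3) a3
        (by positivity) (by positivity)
    have s1 : |f t| + |deriv f t| ≤ (|h t| + |h' t|) + (B / lam ^ 2 + B / lam) := by linarith
    calc Bm * (1 + t) ^ 3 * (|f t| + |deriv f t|) ≤ B * (1 + t) ^ 3 * (|f t| + |deriv f t|) :=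
          mul_le_mul_of_nonneg_right (mul_le_mul_of_nonneg_right hBm hq0) (by positivity)
      _ ≤ B * (1 + t) ^ 3 * ((|h t| + |h' t|) + (B / lam ^ 2 + B / lam)) :=
          mul_le_mul_of_nonneg_left s1 (mul_nonneg hB0 hq0)
      _ = B * ((1 + t) ^ 3 * (|h t| + |h' t|) + (1 + t) ^ 3 * (B / lam ^ 2 + B / lam)) := by ring
      _ ≤ B * ((1 + t) ^ 3 * (|h t| + |h' t|) + E) :=
          mul_le_mul_of_nonneg_left (add_le_add le_rfl hE') hB0
  have hB₃ : ∫ t in (0 : ℝ)..X, |F₃ t| ≤ c3 := by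
    have hT4b := hTb h4 hBl4 hS4 hder4 hT4
    have hT0b := hTb h0 hBl0 hS0 hder0 hT0
    have hpt : ∀ t ∈ Icc 0 X, |F₃ t|
        ≤ prolateGuessA * B * H4 t + prolateGuessA * B * ρb * H0 t + prolateGuessA * B * (1 + ρb) * E := by
      intro t ht
      have h4t : |T4 t| ≤ B * (H4 t + E) := hT4b t ht
      have h0t : |T0 t| ≤ B * (H0 t + E) := hT0b t ht
      have e : |F₃ t| = prolateGuessA * |T4 t - ρl * T0 t| := by
        simp only [hF₃def]; rw [abs_mul, abs_of_pos hA]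
      rw [e]
      have : |T4 t - ρl * T0 t| ≤ B * (H4 t + E) + ρb * (B * (H0 t + E)) := by
        calc _ ≤ |T4 t| + |ρl * T0 t| := abs_sub _ _
          _ = |T4 t| + |ρl| * |T0 t| := by rw [abs_mul]
          _ ≤ _ := add_le_add h4t (mul_le_mul hρlb h0t (abs_nonneg _) hρb0)
      calc prolateGuessA * |T4 t - ρl * T0 t|
          ≤ prolateGuessA * (B * (H4 t + E) + ρb * (B * (H0 t + E))) :=
            mul_le_mul_of_nonneg_left this hA.le
        _ = _ := by ring
    have i1 : IntervalIntegrable (fun t ↦ prolateGuessA * B * H4 t) volume 0 X :=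
      (cH4.intervalIntegrable 0 X).const_mul _
    have i2 : IntervalIntegrable (fun t ↦ prolateGuessA * B * ρb * H0 t) volume 0 X :=
      (cH0.intervalIntegrable 0 X).const_mul _
    have i3 : IntervalIntegrable (fun _ : ℝ ↦ prolateGuessA * B * (1 + ρb) * E) volume 0 X :=
      intervalIntegrable_const
    have step1 : ∫ t in (0 : ℝ)..X, |F₃ t| ≤ ∫ t in (0 : ℝ)..X,
        (prolateGuessA * B * H4 t + prolateGuessA * B * ρb * H0 t + prolateGuessA * B * (1 + ρb) * E) :=
      intervalIntegral.integral_mono_on hX0 hF₃i.abs ((i1.add i2).add i3) hpt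
    have step2 : ∫ t in (0 : ℝ)..X,
        (prolateGuessA * B * H4 t + prolateGuessA * B * ρb * H0 t + prolateGuessA * B * (1 + ρb) * E)
        = prolateGuessA * B * (∫ t in (0 : ℝ)..X, H4 t) + prolateGuessA * B * ρb * (∫ t in (0 : ℝ)..X, H0 t)
          + prolateGuessA * B * (1 + ρb) * E * X := by
      rw [intervalIntegral.integral_add (i1.add i2) i3, intervalIntegral.integral_add i1 i2,
        intervalIntegral.integral_const_mul, intervalIntegral.integral_const_mul,
        intervalIntegral.integral_const, smul_eq_mul]
      ring
    have sH4 : ∫ t in (0 : ℝ)..X, H4 t ≤ J4 := by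
      rw [intervalIntegral.integral_of_le hX0, hJ4def]
      exact setIntegral_le_integral iH4 (Eventually.of_forall hH4nn)
    have sH0 : ∫ t in (0 : ℝ)..X, H0 t ≤ J0 := by
      rw [intervalIntegral.integral_of_le hX0, hJ0def]
      exact setIntegral_le_integral iH0 (Eventually.of_forall hH0nn)
    have sE : prolateGuessA * B * (1 + ρb) * E * X ≤ prolateGuessA * B * (1 + ρb) * (16 * B) := by
      have : prolateGuessA * B * (1 + ρb) * E * X = prolateGuessA * B * (1 + ρb) * (E * X) := by ring
      rw [this]
      exact mul_le_mul_of_nonneg_left hEX (by positivity)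
    have hAB : 0 ≤ prolateGuessA * B := by positivity
    have hABρ : 0 ≤ prolateGuessA * B * ρb := by positivity
    calc ∫ t in (0 : ℝ)..X, |F₃ t| ≤ _ := step1
      _ = _ := step2
      _ ≤ prolateGuessA * B * J4 + prolateGuessA * B * ρb * J0 + prolateGuessA * B * (1 + ρb) * (16 * B) :=
          add_le_add (add_le_add (mul_le_mul_of_nonneg_left sH4 hAB)
            (mul_le_mul_of_nonneg_left sH0 hABρ)) sE
      _ = c3 := by rw [hc3def]; ring
  -- (b4) `∫_{X/2}^λ |F₁|`
  have hB₄ : ∫ t in (X / 2)..lam, |F₁ t| ≤ c4 / lam ^ 2 := by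
    have hX2l : X / 2 ≤ lam := by linarith
    have hsub : uIcc (X / 2) lam ⊆ uIcc 0 lam := by
      rw [uIcc_of_le hX2l, uIcc_of_le hlam0.le]; exact Icc_subset_Icc (by linarith) le_rfl
    have hpt : ∀ t ∈ Icc (X / 2) lam, |F₁ t|
        ≤ prolateGuessA * (|deriv f4 t - hermiteH4' t| + ρb * |deriv f0 t - hermiteH0' t|)
          + prolateGuessA * (1 + ρb) * (2 ^ 15 / lam ^ 3) := by
      intro t ht
      have s4 := e4' t ht.1
      have s0 := e0' t ht.1
      have e : |F₁ t| = prolateGuessA * |((deriv f4 t - hermiteH4' t) + hermiteH4' t)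
          - ρl * ((deriv f0 t - hermiteH0' t) + hermiteH0' t)| := by
        simp only [hF₁def]
        rw [abs_mul, abs_of_pos hA]
        ring_nf
      rw [e]
      have : |((deriv f4 t - hermiteH4' t) + hermiteH4' t)
          - ρl * ((deriv f0 t - hermiteH0' t) + hermiteH0' t)|
          ≤ (|deriv f4 t - hermiteH4' t| + 2 ^ 15 / lam ^ 3)
            + ρb * (|deriv f0 t - hermiteH0' t| + 2 ^ 15 / lam ^ 3) := by
        calc _ ≤ |(deriv f4 t - hermiteH4' t) + hermiteH4' t|
              + |ρl * ((deriv f0 t - hermiteH0' t) + hermiteH0' t)| := abs_sub _ _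
          _ ≤ (|deriv f4 t - hermiteH4' t| + |hermiteH4' t|)
              + |ρl| * (|deriv f0 t - hermiteH0' t| + |hermiteH0' t|) := by
              rw [abs_mul]
              exact add_le_add (abs_add_le _ _)
                (mul_le_mul_of_nonneg_left (abs_add_le _ _) (abs_nonneg _))
          _ ≤ _ := by
              gcongr
      calc _ ≤ prolateGuessA * ((|deriv f4 t - hermiteH4' t| + 2 ^ 15 / lam ^ 3)
            + ρb * (|deriv f0 t - hermiteH0' t| + 2 ^ 15 / lam ^ 3)) :=
            mul_le_mul_of_nonneg_left this hA.le
        _ = _ := by ring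
    have iD4 : IntervalIntegrable (fun t ↦ |deriv f4 t - hermiteH4' t|) volume (X / 2) lam :=
      ((h4.intervalIntegrable_deriv.sub (continuous_hermiteH4'.intervalIntegrable _ _)).abs).mono_set
        hsub
    have iD0 : IntervalIntegrable (fun t ↦ |deriv f0 t - hermiteH0' t|) volume (X / 2) lam :=
      ((h0.intervalIntegrable_deriv.sub (continuous_hermiteH0'.intervalIntegrable _ _)).abs).mono_set
        hsub
    have i12 : IntervalIntegrable (fun t ↦ prolateGuessA * (|deriv f4 t - hermiteH4' t|
        + ρb * |deriv f0 t - hermiteH0' t|)) volume (X / 2) lam :=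
      (iD4.add (iD0.const_mul ρb)).const_mul _
    have i3 : IntervalIntegrable (fun _ : ℝ ↦ prolateGuessA * (1 + ρb) * (2 ^ 15 / lam ^ 3))
        volume (X / 2) lam := intervalIntegrable_const
    have step1 : ∫ t in (X / 2)..lam, |F₁ t| ≤ ∫ t in (X / 2)..lam,
        (prolateGuessA * (|deriv f4 t - hermiteH4' t| + ρb * |deriv f0 t - hermiteH0' t|)
          + prolateGuessA * (1 + ρb) * (2 ^ 15 / lam ^ 3)) :=
      intervalIntegral.integral_mono_on hX2l ((hF₁i.mono_set hsub).abs) (i12.add i3) hpt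
    have step2 : ∫ t in (X / 2)..lam,
        (prolateGuessA * (|deriv f4 t - hermiteH4' t| + ρb * |deriv f0 t - hermiteH0' t|)
          + prolateGuessA * (1 + ρb) * (2 ^ 15 / lam ^ 3))
        = prolateGuessA * ((∫ t in (X / 2)..lam, |deriv f4 t - hermiteH4' t|)
            + ρb * ∫ t in (X / 2)..lam, |deriv f0 t - hermiteH0' t|)
          + prolateGuessA * (1 + ρb) * (2 ^ 15 / lam ^ 3) * (lam - X / 2) := by
      rw [intervalIntegral.integral_add i12 i3, intervalIntegral.integral_const_mul,
        intervalIntegral.integral_add iD4 (iD0.const_mul ρb), intervalIntegral.integral_const_mul,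
        intervalIntegral.integral_const, smul_eq_mul]
      ring
    have hIW : ∀ {f h' : ℝ → ℝ} {m : ℕ} {Km : ℝ}, IsProlateFunction lam m f → Continuous h' →
        Km ≤ KW → (∫ x in (0 : ℝ)..lam, |deriv f x - h' x| * (1 + x)) ≤ Km / lam ^ 2 →
        ∫ t in (X / 2)..lam, |deriv f t - h' t| ≤ KW / lam ^ 2 := by
      intro f h' m Km hf hc hKm hW
      have i0 : IntervalIntegrable (fun t ↦ |deriv f t - h' t|) volume 0 lam :=
        (hf.intervalIntegrable_deriv.sub (hc.intervalIntegrable _ _)).abs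
      have i1 : IntervalIntegrable (fun t ↦ |deriv f t - h' t| * (1 + t)) volume 0 lam :=
        i0.mul_continuousOn (by fun_prop)
      calc ∫ t in (X / 2)..lam, |deriv f t - h' t| ≤ ∫ t in (0 : ℝ)..lam, |deriv f t - h' t| :=
            intervalIntegral.integral_mono_interval (by linarith) hX2l le_rfl
              (Eventually.of_forall fun _ ↦ abs_nonneg _) i0
        _ ≤ ∫ t in (0 : ℝ)..lam, |deriv f t - h' t| * (1 + t) :=
            intervalIntegral.integral_mono_on hlam0.le i0 i1 fun t ht ↦
              le_mul_of_one_le_right (abs_nonneg _) (by linarith [ht.1])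
        _ ≤ Km / lam ^ 2 := hW
        _ ≤ KW / lam ^ 2 := div_le_div_of_nonneg_right hKm hl2.le
    have hI4 := hIW h4 continuous_hermiteH4' hKW4' hW4
    have hI0 := hIW h0 continuous_hermiteH0' hKW0' hW0
    have htail : prolateGuessA * (1 + ρb) * (2 ^ 15 / lam ^ 3) * (lam - X / 2)
        ≤ prolateGuessA * (1 + ρb) * (2 ^ 15 / lam ^ 2) := by
      have h1 : 2 ^ 15 / lam ^ 3 * (lam - X / 2) ≤ 2 ^ 15 / lam ^ 2 := by
        rw [div_mul_eq_mul_div, div_le_div_iff₀ (by positivity) hl2]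
        have h0 : lam - X / 2 ≤ lam := by linarith only [hX0]
        calc (2 : ℝ) ^ 15 * (lam - X / 2) * lam ^ 2 = 2 ^ 15 * lam ^ 2 * (lam - X / 2) := by ring
          _ ≤ 2 ^ 15 * lam ^ 2 * lam := mul_le_mul_of_nonneg_left h0 (by positivity)
          _ = 2 ^ 15 * lam ^ 3 := by ring
      calc _ = prolateGuessA * (1 + ρb) * (2 ^ 15 / lam ^ 3 * (lam - X / 2)) := by ring
        _ ≤ _ := mul_le_mul_of_nonneg_left h1 (by positivity)
    calc ∫ t in (X / 2)..lam, |F₁ t| ≤ _ := step1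
      _ = _ := step2
      _ ≤ prolateGuessA * (KW / lam ^ 2 + ρb * (KW / lam ^ 2))
          + prolateGuessA * (1 + ρb) * (2 ^ 15 / lam ^ 2) :=
          add_le_add (mul_le_mul_of_nonneg_left (add_le_add hI4
            (mul_le_mul_of_nonneg_left hI0 hρb0)) hA.le) htail
      _ = c4 / lam ^ 2 := by rw [hc4def]; ring
  -- assemble
  have key := abs_connesE_le_of_cells hX2 hXl hcont hF hF₁ hF₂ hF₃i hF₁i hsupp hint hF10 hB₀ hB₁
    hB₂ hB₃ hB₄ hu0 hu1
  refine key.trans (mul_le_mul_of_nonneg_left ?_ (Real.sqrt_nonneg u))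
  have hc2 : 0 ≤ c2 := by positivity
  have hc3 : 0 ≤ c3 := by positivity
  have t2 : u * (c2 / lam) / 12 ≤ c2 / 12 / lam ^ 2 := by
    have h1 : u * (c2 / lam) ≤ (1 / lam) * (c2 / lam) :=
      mul_le_mul_of_nonneg_right hul (by positivity)
    have h2 : (1 / lam) * (c2 / lam) = c2 / lam ^ 2 := by field_simp
    have h3 : c2 / 12 / lam ^ 2 = c2 / lam ^ 2 / 12 := by ring
    rw [h3]; linarith
  have t3 : u ^ 2 * c3 ≤ c3 / lam ^ 2 := by
    have h1 : u ^ 2 ≤ (1 / lam) ^ 2 := pow_le_pow_left₀ hu0.le hul 2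
    have h2 : (1 / lam) ^ 2 = 1 / lam ^ 2 := by rw [one_div_pow]
    rw [h2] at h1
    calc u ^ 2 * c3 ≤ (1 / lam ^ 2) * c3 := mul_le_mul_of_nonneg_right h1 hc3
      _ = c3 / lam ^ 2 := by ring
  have e : (c0 / 2 + c1 / 2 + c2 / 12 + c3 + c4 + 3 * c1) / lam ^ 2
      = c0 / lam ^ 2 / 2 + c1 / lam ^ 2 / 2 + c2 / 12 / lam ^ 2 + c3 / lam ^ 2 + c4 / lam ^ 2
        + 3 * (c1 / lam ^ 2) := by ring
  rw [e]
  linarith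

set_option maxHeartbeats 800000 in
/-- **Connes' Fact 6.4 with the rate `O(λ⁻²)`, uniformly on closed substrips.**  For
`0 ≤ α₀ < ½` there are `C, Λ` with `‖4M_λ(s) − ξ(½+s)‖ ≤ C/λ²` for all `λ ≥ Λ`, all prolate
`h_{0,λ}, h_{4,λ}` and all `s` with `|Re s| ≤ α₀`.  This sharpens the printed rate
`O(λ^{−1/2−Re s})` of CCM25 (proof of Lemma 7.3; `prolateGuess_rate`): the main term
`4ζ(s+½)(𝓜h_λ − 𝓜h)(s+½)` is `O(λ⁻²)` by the `W^{1,1}` rates (`prolateGuessH_rate`), and the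
boundary piece `4∫_0^{1/λ} 𝓔(h_λ)(u)u^{s−1}du` is `O(λ⁻²)` because `|𝓔(h_λ)(u)| ≤ C√u/λ²` on
`(0, 1/λ]` (`abs_connesE_prolateGuessH_le`, third-order Euler–Maclaurin) instead of the
variation bound `(V_λ + M)λ^{−(½+Re s)}` used for the printed rate.
[cite: ConnesConsaniMoscovici2025, Lemma 7.3; Connes2026Letter, §6.4 Fact 6.4] -/
theorem prolateGuess_rate_sharp :
    ∀ α₀ : ℝ, 0 ≤ α₀ → α₀ < 1 / 2 → ∃ C Λ : ℝ, ∀ lam : ℝ, Λ ≤ lam → ∀ f0 f4 : ℝ → ℝ,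
      IsProlateFunction lam 0 f0 → IsProlateFunction lam 4 f4 → ∀ s : ℂ, |s.re| ≤ α₀ →
        ‖4 * prolateGuessMellin lam f0 f4 s - riemannXi (1 / 2 + s)‖ ≤ C / lam ^ 2 := by
  intro α₀ hα hα'
  obtain ⟨K, Λ, hK0, hK⟩ := prolateGuessH_rate w11Rate_zero w11Rate_four
  obtain ⟨CE, ΛE, hCE0, hCE⟩ := abs_connesE_prolateGuessH_le
  have ha : 0 < 1 / 2 - α₀ := by linarith
  have hπ := Real.pi_gt_three
  set T₀ : ℝ := 3 * π ^ 3 / 2 + 7 * π ^ 2 / 2 + 3 * π / 2 with hT₀def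
  have hT₀ : 0 ≤ T₀ := by positivity
  refine ⟨4 * (2 / (1 / 2 - α₀)) * (K + K + T₀ / 2) + 4 * (CE / (1 / 2 - α₀)),
    max (max Λ ΛE) 1, fun lam hlam f0 f4 h0 h4 s hs ↦ ?_⟩
  obtain ⟨hl', hlam1⟩ := max_le_iff.1 hlam
  obtain ⟨hlΛ, hlE⟩ := max_le_iff.1 hl'
  have hlam0 : 0 < lam := by linarith
  have hl2 : 0 < lam ^ 2 := by positivity
  obtain ⟨hs1, hs2⟩ := abs_le.1 hs
  have hσlt : |s.re| < 1 / 2 := lt_of_le_of_lt hs hα'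
  have hb : 0 < s.re + 1 / 2 := by linarith
  have hb1 : s.re + 1 / 2 ≤ 1 := by linarith
  have hbσ : 1 / 2 - α₀ ≤ s.re + 1 / 2 := by linarith
  have hbσ' : 1 / 2 - α₀ ≤ 1 / 2 - s.re := by linarith
  have hs' : -(1 / 2 : ℝ) < s.re := by linarith
  have hs1' : s ≠ 1 / 2 := by
    intro h
    rw [h] at hs2
    norm_num at hs2
    linarith
  obtain ⟨hE, hW⟩ := hK lam hlΛ f0 f4 h0 h4
  have hζ := norm_riemannZeta_div_le_of_abs_re_lt hσlt
  have hdec := four_mul_prolateGuessMellin_sub_riemannXi_of_even h0 h4 hs' hs1'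
  -- abbreviations
  set w : ℂ := s + 1 / 2 with hw_def
  have hwre : w.re = s.re + 1 / 2 := by
    simp only [hw_def, Complex.add_re, one_div]
    norm_num
  have hw : 0 < w.re := by rw [hwre]; exact hb
  have hw0 : w ≠ 0 := by
    rintro h
    rw [h] at hw
    simp at hw
  set Em := mellin (fun x ↦ (prolateGuessH lam f0 f4 x : ℂ)) w
      - mellin (fun x ↦ (connesHermiteH x : ℂ)) w with hEm
  set Z := 4 * riemannZeta w * Em with hZ
  set Bd := ∫ u in Ioc 0 (1 / lam), (connesE (prolateGuessH lam f0 f4) u : ℂ) * (u : ℂ) ^ (s - 1)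
    with hBd
  have hmain := norm_mul_mellin_prolateGuessH_sub_le h0 h4 hw
  rw [← hEm, hwre] at hmain
  -- integrability bookkeeping on `[0, λ]`
  obtain ⟨-, hdi⟩ := prolateGuessH_hasDerivAt h0 h4
  have i_diff : IntervalIntegrable
      (fun x ↦ |deriv (prolateGuessH lam f0 f4) x - connesHermiteH' x|) volume 0 lam :=
    (hdi.sub (continuous_connesHermiteH'.intervalIntegrable 0 lam)).abs
  have i_W : IntervalIntegrable
      (fun x ↦ |deriv (prolateGuessH lam f0 f4) x - connesHermiteH' x| * (1 + x)) volume 0 lam :=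
    i_diff.mul_continuousOn (by fun_prop)
  have i_b : IntervalIntegrable
      (fun x ↦ |deriv (prolateGuessH lam f0 f4) x - connesHermiteH' x| * x ^ (s.re + 1 / 2))
        volume 0 lam :=
    i_diff.mul_continuousOn (Real.continuous_rpow_const hb.le).continuousOn
  have rpow_le : ∀ {x e : ℝ}, 0 ≤ x → 0 ≤ e → e ≤ 1 → x ^ e ≤ 1 + x := by
    intro x e hx he₀ he₁
    rcases le_or_gt x 1 with h | h
    · exact (Real.rpow_le_one hx h he₀).trans (by linarith)
    · exact (Real.rpow_le_self_of_one_le h.le he₁).trans (by linarith)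
  -- (1) end-point term
  have t1 : |prolateGuessH lam f0 f4 lam| * lam ^ (s.re + 1 / 2) ≤ K / lam ^ 2 := by
    have h1 : lam ^ (s.re + 1 / 2) ≤ lam := Real.rpow_le_self_of_one_le hlam1 hb1
    exact (mul_le_mul_of_nonneg_left h1 (abs_nonneg _)).trans hE
  -- (2) weighted derivative term
  have t2 : (∫ x in (0 : ℝ)..lam,
      |deriv (prolateGuessH lam f0 f4) x - connesHermiteH' x| * x ^ (s.re + 1 / 2)) ≤ K / lam ^ 2 := by
    refine le_trans ?_ hW
    refine intervalIntegral.integral_mono_on hlam0.le i_b i_W (fun x hx ↦ ?_)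
    exact mul_le_mul_of_nonneg_left (rpow_le hx.1 hb.le hb1) (abs_nonneg _)
  -- (3) Gaussian tail
  have t3 : (∫ x in Ioi lam, |connesHermiteH' x| * x ^ (s.re + 1 / 2)) ≤ T₀ / (2 * lam ^ 2) :=
    integral_Ioi_abs_connesHermiteH'_mul_rpow_le hb hb1 hlam1
  have t3' : T₀ / (2 * lam ^ 2) = (T₀ / 2) / lam ^ 2 := by
    rw [div_div]
  have hsum : |prolateGuessH lam f0 f4 lam| * lam ^ (s.re + 1 / 2)
        + (∫ x in (0 : ℝ)..lam,
            |deriv (prolateGuessH lam f0 f4) x - connesHermiteH' x| * x ^ (s.re + 1 / 2))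
        + (∫ x in Ioi lam, |connesHermiteH' x| * x ^ (s.re + 1 / 2))
      ≤ (K + K + T₀ / 2) / lam ^ 2 := by
    rw [add_div, add_div, ← t3']
    linarith
  have hfac : 1 / (1 / 2 - s.re) + 1 / (1 / 2 + s.re) ≤ 2 / (1 / 2 - α₀) := by
    have e1 : 1 / (1 / 2 - s.re) ≤ 1 / (1 / 2 - α₀) := one_div_le_one_div_of_le ha hbσ'
    have e2 : 1 / (1 / 2 + s.re) ≤ 1 / (1 / 2 - α₀) :=
      one_div_le_one_div_of_le ha (by linarith)
    have : 2 / (1 / 2 - α₀) = 1 / (1 / 2 - α₀) + 1 / (1 / 2 - α₀) := by ring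
    linarith
  -- the main term
  have hZeq : Z = 4 * ((riemannZeta w / w) * (w * Em)) := by
    rw [hZ]; field_simp
  have hZn : ‖Z‖ ≤ 4 * (2 / (1 / 2 - α₀)) * (K + K + T₀ / 2) / lam ^ 2 := by
    rw [hZeq, norm_mul, norm_mul]
    have h4n : ‖(4 : ℂ)‖ = 4 := by simp
    rw [h4n]
    have := mul_le_mul (hζ.trans hfac) (hmain.trans hsum) (norm_nonneg _) (by positivity)
    calc 4 * (‖riemannZeta w / w‖ * ‖w * Em‖)
        ≤ 4 * (2 / (1 / 2 - α₀) * ((K + K + T₀ / 2) / lam ^ 2)) :=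
          mul_le_mul_of_nonneg_left this (by norm_num)
      _ = _ := by ring
  -- the boundary term
  have hBdn : ‖Bd‖ ≤ CE / (1 / 2 - α₀) / lam ^ 2 := by
    have hT : (0 : ℝ) < 1 / lam := by positivity
    have h := norm_setIntegral_Ioc_connesE_le_of_sqrt_bound hT (hCE lam hlE f0 f4 h0 h4) hs'
    have h1 : (1 / lam) ^ (s.re + 1 / 2) ≤ 1 :=
      Real.rpow_le_one hT.le (by rw [div_le_one hlam0]; exact hlam1) hb.le
    have hCl : 0 ≤ CE / lam ^ 2 := by positivity
    have h2 : CE / lam ^ 2 * (1 / lam) ^ (s.re + 1 / 2) ≤ CE / lam ^ 2 := by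
      calc CE / lam ^ 2 * (1 / lam) ^ (s.re + 1 / 2) ≤ CE / lam ^ 2 * 1 :=
            mul_le_mul_of_nonneg_left h1 hCl
        _ = CE / lam ^ 2 := mul_one _
    have h3 : CE / lam ^ 2 * (1 / lam) ^ (s.re + 1 / 2) / (s.re + 1 / 2)
        ≤ CE / lam ^ 2 / (s.re + 1 / 2) := div_le_div_of_nonneg_right h2 hb.le
    have h4 : CE / lam ^ 2 / (s.re + 1 / 2) ≤ CE / lam ^ 2 / (1 / 2 - α₀) :=
      div_le_div_of_nonneg_left hCl ha hbσ
    have h5 : CE / lam ^ 2 / (1 / 2 - α₀) = CE / (1 / 2 - α₀) / lam ^ 2 := by ring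
    linarith [h, h3, h4, h5.le]
  have h4n : ‖(4 : ℂ) * Bd‖ = 4 * ‖Bd‖ := by
    rw [norm_mul]
    norm_num
  calc ‖4 * prolateGuessMellin lam f0 f4 s - riemannXi (1 / 2 + s)‖ = ‖Z - 4 * Bd‖ := by
        rw [hdec]
    _ ≤ ‖Z‖ + ‖4 * Bd‖ := norm_sub_le _ _
    _ = ‖Z‖ + 4 * ‖Bd‖ := by rw [h4n]
    _ ≤ 4 * (2 / (1 / 2 - α₀)) * (K + K + T₀ / 2) / lam ^ 2
        + 4 * (CE / (1 / 2 - α₀) / lam ^ 2) :=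
        add_le_add hZn (mul_le_mul_of_nonneg_left hBdn (by norm_num))
    _ = (4 * (2 / (1 / 2 - α₀)) * (K + K + T₀ / 2) + 4 * (CE / (1 / 2 - α₀))) / lam ^ 2 := by
        ring

/-- Fourth in-tree proof of the landed qualitative statement `prolateGuess_tendsto_riemannXi`
(Connes' Fact 6.4, file `ConnesProlateGuess.lean`), now through the sharp rate: `C/λ² ≤ ε` for
`λ` large. [cite: Connes2026Letter, §6.4 Fact 6.4] -/
example : prolateGuess_tendsto_riemannXi := by
  intro α₀ hα hα' ε hε
  obtain ⟨C, Λ, hC⟩ := prolateGuess_rate_sharp α₀ hα hα'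
  refine ⟨max (max Λ 1) (max C 0 / ε + 1), fun lam hlam f0 f4 h0 h4 s hs ↦ ?_⟩
  obtain ⟨h1, h2⟩ := max_le_iff.1 hlam
  obtain ⟨hlΛ, hlam1⟩ := max_le_iff.1 h1
  have hlam0 : 0 < lam := by linarith
  have hC0 : C ≤ max C 0 := le_max_left _ _
  have hM0 : 0 ≤ max C 0 := le_max_right _ _
  refine (hC lam hlΛ f0 f4 h0 h4 s hs).trans ?_
  have hl : max C 0 / ε ≤ lam := by linarith
  have hle : max C 0 ≤ ε * lam := by
    have := (div_le_iff₀ hε).1 hl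
    linarith
  have hl2 : lam ≤ lam ^ 2 := by nlinarith
  calc C / lam ^ 2 ≤ max C 0 / lam ^ 2 := div_le_div_of_nonneg_right hC0 (by positivity)
    _ ≤ ε * lam / lam ^ 2 := div_le_div_of_nonneg_right (hle) (by positivity)
    _ = ε / lam := by field_simp
    _ ≤ ε := div_le_self hε.le hlam1

end Literature.NumberTheory.LFunctions
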